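import Literature.MathematicalPhysics.QuantumFieldTheory.Balaban1983to89.Node00.OpsYSectEElim

/-!
# NODE 00 — Sect. E of [B9]: the pivot coefficients of the bond elimination `C(V)` are units for small fields, and on their gauge orbits

[cite: Balaban1985BackgroundPropagators, (3.157) p.428, (3.28)–(3.34) pp.395–396, (3.35) p.397, (3.9) p.391, (3.169) p.430; Balaban1985Averaging, (55)–(58) p.27, (124)–(126) p.36, (109) p.34]

`Node00/OpsYSectEElim.lean` (FILE 13 of the def-Y lineage) builds the covariant axial-gauge bond elimination `C(V) = elimCY` of (3.157) and its flat transpose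
`C(V)* = elimCtY`, solving the one-step averaging constraint `(Q(V)B)(c) = 0` ([5] (125)) at every coarse bond `c ∈ Λ′` for the pivot value `B(b₀(c))`
through the PIVOT COEFFICIENT `K_c(V) = KY : a ↦ (Q(V)(δ_{b₀(c)} ⊗ a))(c)`, inverted by `Ring.inverse`. Three faces of FILE 13 carry the hypothesis
`IsUnit (K_c(V))` (resp. `IsUnit (K_c(V)*)`): the constraints on the range `Q1Y_elimCY`, the parametrisation `elimCY_eq_self_of_constraints` and the
adjointness `sum_tr_elimCY_mul`; FILE 13 discharges them at `U = 1` only (`KY_one : K_c(1) = L^{−(d+1)}·id`).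

THIS FILE discharges them in the SMALL-FIELD REGIME: if the averaged bond field `V = 𝔳 U` takes values in a group of contractions (`‖g‖ ≤ 1`, e.g.
`U(N)`) and `‖V(b) − 1‖ ≤ δ` on every unit bond with `L^{d+1}·2δ·(L + (d+1)ℓ) < 1`, then `K_c(V)` and `K_c(V)*` are UNITS of the (complete) fibre:
each of the `L·L^{d+1}` (segment, bond) readings of the pivot in `(Q(V)·)(c)` is carried by at most `L + (d+1)ℓ` transports `Ad(V(b))` (the straight
segment and the block comb `Γ_{c₋,z}`, `length_uΓ_le`), each within `2δ` of the identity (`norm_R_sub_self_le_of_le`), so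
`‖K_c(V)a − L^{−(d+1)}a‖ ≤ 2δ(L + (d+1)ℓ)‖a‖` (`norm_KY_sub_le`, and `norm_KTY_sub_le` for the transposed readings through `Ad(V(b))⁻¹`,
`R(V(Γ))⁻¹`) and `L^{d+1}K_c(V) = 1 − T` with `‖T‖ < 1` in the Banach algebra `𝔸 →L[ℂ] 𝔸` (`isUnit_of_norm_smul_sub_le`, Neumann series via
`Units.oneSub`, transferred to `Module.End ℂ 𝔸`). Print: [5] p.36 — the operators in (124) beyond the main term «can be estimated by O(L²α₀)»,
(126) `|(Q(V₀)A)_c| ≤ (1 + O(1)L²α₀)α₁`; the same near-identity mechanism.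

AND ON GAUGE ORBITS (§4–§5): transports conjugated by a site function `γ` telescope along CHAINS (`hol_conj_apply`, `trSum_conj`, `trSumT_conj` — the
generic form of print's contour law «R(U^u(Γ_{y,x})) = R(u(y))R(U(Γ_{y,x}))R(u⁻¹(x))», (3.32)); the block combs `Γ_{ȳ,y}` are chains (`axialFrameY`) and
so are the straight segments `[z, z(c)]` (`usegY_chain`); hence under the gauge action `V^γ(b) = γ(b₋)V(b)γ(b₊)⁻¹` of [5] (55) (`ugaugeY`) the averaging
operation (125) is COVARIANT, `(Q(V^γ)(R(γ(·₋))B))(c) = R(γ(c₋))(Q(V)B)(c)` (`Q1Y_ugauge` — print p.396: «inspecting the definitions of the averaging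
operators Q_j(U) for gauge fields we can see that the equalities (3.32) hold again»), and so are the pivot coefficients: `K_c(V^γ)·Ad γ(b₀(c)₋) =
Ad γ(c₋)·K_c(V)` (`KY_ugauge_comp`), `K_c(V^γ)*·Ad γ(c₋) = Ad γ(b₀(c)₋)·K_c(V)*` (`KTY_ugauge_comp`). INVERTIBILITY OF `K_c(V)`, `K_c(V)*` IS THEREFORE A
GAUGE-ORBIT PROPERTY (`isUnit_KY_ugauge_iff`, `isUnit_KTY_ugauge_iff`), and every `V` gauge equivalent to a small field has invertible pivot coefficients
(`isUnit_KY_of_ugauge_smallVY`) with the three faces hypothesis-free (`Q1Y_elimCY_∕elimCY_eq_self_of_constraints_∕sum_tr_elimCY_mul_of_ugauge_smallVY`).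
The letter `C(V)` itself is gauge covariant with NO hypothesis: `C(V^γ)(R(γ(·₋))B) = R(γ(·₋))(C(V)B)` (`elimCY_ugauge`, through `ringInverse_KY_ugauge`:
`Ring.inverse` of the pivot coefficient is covariant, both sides vanishing off the common invertibility locus), and so is its transpose `C(V)*`
(`placeUY_conj`, `Q1TY_ugauge`, `ringInverse_KTY_ugauge`, `elimCtY_ugauge`).
At the record, the averaged field `V = avYOfRecord x U` transforms as a contour variable under `U ↦ U^u` (`avYOfRecord_gaugeY`, from
`parBY_isGaugeLawB` of `Node00.OpsYGauge`), so `K_c(V(U^u))` is a unit iff `K_c(V(U))` is (`isUnit_KY_avYOfRecord_gaugeY_iff`) and a background gauge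
equivalent to one with small averaged field has invertible pivot coefficients (`isUnit_KY_avYOfRecord_of_gaugeY_smallVY`).

## Honest margins
(i) PRINT'S REGIME IS WIDER. (3.35) / [5] (109) is small CURVATURE (`|V(∂p) − 1| ≤ α₀`), not small field. Of the reduction «small curvature ⇒ gauge
equivalent to a small field» this file formalises the GAUGE half (§5: invertibility is a gauge-orbit property, `isUnit_KY_of_ugauge_smallVY`); the
EXISTENCE half — an axial gauge `u` on the block neighbourhood of `c` with `|V^u(b) − 1| = O(L²α₀)` ([5] (55)–(58), Prop. 1) — is NOT formalised: the
hypotheses `SmallVY x 𝔳′ G U′ δ` + `𝔳′ U′ = V^γ` name exactly what is used. The smallness is asked on ALL unit bonds (print needs it near `c` only).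
(ii) CONSTANTS are cruder than print's (`2δ(L + (d+1)ℓ)·L^{d+1}` from counting transports, against print's `O(L²α₀)`); they depend on `d, L` only.
(iii) Nothing here touches `D2J`, `Gt2` (still the parameters `𝔢₀` of `sectEYOfRecordV6`), nor (3.158)–(3.185).
(iv) `U = 1` is the case `δ = 0` (`smallVY_avYOfRecord_one`), consistent with FILE 13's unconditional U = 1 faces; §2c lands the transposes at `U = 1`
directly (`KTY_one`, `isUnit_KTY_one`: `K_c(1)* = L^{−(d+1)}·id`) and the hypothesis-free U = 1 trace pairing `sum_tr_elimCY_mul_one` (dag-ref-E READ-3 on FILE 13).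
-/

noncomputable section

namespace Literature.MathematicalPhysics.QuantumFieldTheory.Balaban1983to89.Node00

open B9Eq3169Mu
open B9Eq39Adjoint (R R_one)
open B9PinMembersKLevelV1 (MemberY)
open B6Elimination (corner mem_block_corner_iff corner_corner)
open B6GlobalChartV1 (PV domT)
open B6BondElimination (unitVec)

variable {d ℓ : ℕ} {hd : 1 ≤ d + 1} {hL : Odd (ℓ + 1) ∧ 1 < ℓ + 1} {b₀ b₁ : ℝ} {Mstar : ℕ}

/-! ## §1 Near-identity transports along contours (generic estimates) -/

section SmallField

variable {𝔸 : Type} [NormedRing 𝔸] [NormedAlgebra ℂ 𝔸] [CompleteSpace 𝔸]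

omit [NormedAlgebra ℂ 𝔸] [CompleteSpace 𝔸] in
/-- **`‖Ad(V)a − a‖ ≤ 2δ‖a‖` for `‖V − 1‖ ≤ δ`, `‖V⁻¹‖ ≤ 1`** (`VaV⁻¹ − a = (V − 1)aV⁻¹ + aV⁻¹(1 − V)`; cf. `B11Eq135Weitzenbock.norm_R_sub_self_le`, the `δ`-free
form, outside this file's import closure). [cite: Balaban1985BackgroundPropagators, (3.35) p.397 + (3.3) p.390, bookkeeping] -/
theorem norm_R_sub_self_le_of_le {V : 𝔸ˣ} (h2 : ‖((V⁻¹ : 𝔸ˣ) : 𝔸)‖ ≤ 1) {δ : ℝ} (hδ : ‖(V : 𝔸) - 1‖ ≤ δ) (a : 𝔸) : ‖R V a - a‖ ≤ 2 * δ * ‖a‖ := by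
  have e : R V a - a = ((V : 𝔸) - 1) * a * ((V⁻¹ : 𝔸ˣ) : 𝔸) + a * ((V⁻¹ : 𝔸ˣ) : 𝔸) * (1 - (V : 𝔸)) := by
    have h1 : a * ((V⁻¹ : 𝔸ˣ) : 𝔸) * (V : 𝔸) = a := by rw [mul_assoc, Units.inv_mul, mul_one]
    unfold R
    rw [sub_mul, sub_mul, one_mul, mul_sub, mul_one, h1]
    abel
  rw [e]
  refine (norm_add_le _ _).trans ?_
  have hA : ‖((V : 𝔸) - 1) * a * ((V⁻¹ : 𝔸ˣ) : 𝔸)‖ ≤ δ * ‖a‖ := by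
    refine (norm_mul_le _ _).trans ?_
    refine (mul_le_mul (norm_mul_le _ _) h2 (norm_nonneg _) (by positivity)).trans ?_
    rw [mul_one]
    exact mul_le_mul_of_nonneg_right hδ (norm_nonneg a)
  have hB : ‖a * ((V⁻¹ : 𝔸ˣ) : 𝔸) * (1 - (V : 𝔸))‖ ≤ ‖a‖ * δ := by
    refine (norm_mul_le _ _).trans ?_
    rw [norm_sub_rev]
    refine mul_le_mul ((norm_mul_le _ _).trans ?_) hδ (norm_nonneg _) (norm_nonneg _)
    calc ‖a‖ * ‖((V⁻¹ : 𝔸ˣ) : 𝔸)‖ ≤ ‖a‖ * 1 := by gcongr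
      _ = ‖a‖ := mul_one _
  linarith

omit [NormedAlgebra ℂ 𝔸] [CompleteSpace 𝔸] in
/-- **transport along a contour of near-identity transports moves a value by at most `|Γ|·δ`**. [cite: Balaban1985BackgroundPropagators, (3.35) p.397, (3.169) p.430, bookkeeping] -/
theorem norm_hol_sub_self_le [NormedSpace ℝ 𝔸] {Bond : Type} (T : Bond → 𝔸 ≃ₗ[ℝ] 𝔸) (hT : ∀ b v, ‖T b v‖ ≤ ‖v‖) {δ : ℝ}
    (hδ : ∀ b v, ‖T b v - v‖ ≤ δ * ‖v‖) : ∀ (Γ : List Bond) (v : 𝔸), ‖hol T Γ v - v‖ ≤ Γ.length * δ * ‖v‖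
  | [], v => by simp
  | b :: Γ, v => by
      rw [hol_cons_apply, List.length_cons]
      have e : T b (hol T Γ v) - v = T b (hol T Γ v - v) + (T b v - v) := by rw [map_sub]; abel
      rw [e]
      refine (norm_add_le _ _).trans ?_
      have h1 := (hT b _).trans (norm_hol_sub_self_le T hT hδ Γ v)
      have h2 := hδ b v
      push_cast
      linarith

omit [NormedAlgebra ℂ 𝔸] [CompleteSpace 𝔸] in
/-- the inverse transport along a contour of near-identity transports moves a value by at most `|Γ|·δ`. [cite: Balaban1985BackgroundPropagators, (3.35) p.397, (3.169) p.430, bookkeeping] -/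
theorem norm_hol_symm_sub_self_le [NormedSpace ℝ 𝔸] {Bond : Type} (T : Bond → 𝔸 ≃ₗ[ℝ] 𝔸) (hT' : ∀ b v, ‖(T b).symm v‖ ≤ ‖v‖) {δ : ℝ} (hδ0 : 0 ≤ δ)
    (hδ' : ∀ b v, ‖(T b).symm v - v‖ ≤ δ * ‖v‖) : ∀ (Γ : List Bond) (v : 𝔸), ‖(hol T Γ).symm v - v‖ ≤ Γ.length * δ * ‖v‖
  | [], v => by simp
  | b :: Γ, v => by
      have e0 : (hol T (b :: Γ)).symm v = (hol T Γ).symm ((T b).symm v) := rfl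
      rw [e0, List.length_cons]
      have e : (hol T Γ).symm ((T b).symm v) - v = ((hol T Γ).symm ((T b).symm v) - (T b).symm v) + ((T b).symm v - v) := by abel
      rw [e]
      refine (norm_add_le _ _).trans ?_
      have h3 : (0 : ℝ) ≤ Γ.length * δ := by positivity
      have h1 := (norm_hol_symm_sub_self_le T hT' hδ0 hδ' Γ ((T b).symm v)).trans (mul_le_mul_of_nonneg_left (hT' b v) h3)
      have h2 := hδ' b v
      push_cast
      linarith

omit [NormedAlgebra ℂ 𝔸] [CompleteSpace 𝔸] in
/-- a list sum of values of norm `≤ M` has norm `≤ |Γ|·M`. [cite: Balaban1985BackgroundPropagators, (3.169) p.430, bookkeeping] -/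
theorem norm_list_sum_map_le {Bond : Type} (B : Bond → 𝔸) {M : ℝ} (hM : ∀ b, ‖B b‖ ≤ M) : ∀ Γ : List Bond, ‖(Γ.map B).sum‖ ≤ Γ.length * M
  | [] => by simp
  | b :: Γ => by
      rw [List.map_cons, List.sum_cons, List.length_cons]
      refine (norm_add_le _ _).trans ?_
      have := norm_list_sum_map_le B hM Γ
      have := hM b
      push_cast
      linarith

omit [NormedAlgebra ℂ 𝔸] [CompleteSpace 𝔸] in
/-- **the transported sum along a contour of near-identity transports differs from the plain sum by at most `|Γ|²·δ·M`**. [cite: Balaban1985BackgroundPropagators, (3.35) p.397, (3.169) p.430, bookkeeping] -/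
theorem norm_trSum_sub_sum_le [NormedSpace ℝ 𝔸] {Bond : Type} (T : Bond → 𝔸 ≃ₗ[ℝ] 𝔸) (hT : ∀ b v, ‖T b v‖ ≤ ‖v‖) {δ : ℝ} (hδ0 : 0 ≤ δ)
    (hδ : ∀ b v, ‖T b v - v‖ ≤ δ * ‖v‖) (B : Bond → 𝔸) {M : ℝ} (hM0 : 0 ≤ M) (hM : ∀ b, ‖B b‖ ≤ M) :
    ∀ Γ : List Bond, ‖trSum T B Γ - (Γ.map B).sum‖ ≤ Γ.length ^ 2 * δ * M
  | [] => by simp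
  | b :: Γ => by
      rw [trSum_cons, List.map_cons, List.sum_cons, List.length_cons]
      have e : B b + T b (trSum T B Γ) - (B b + (Γ.map B).sum) = T b (trSum T B Γ - (Γ.map B).sum) + (T b (Γ.map B).sum - (Γ.map B).sum) := by
        rw [map_sub]; abel
      rw [e]
      refine (norm_add_le _ _).trans ?_
      have h1 := (hT b _).trans (norm_trSum_sub_sum_le T hT hδ0 hδ B hM0 hM Γ)
      have h2 := (hδ b _).trans (mul_le_mul_of_nonneg_left (norm_list_sum_map_le B hM Γ) hδ0)
      have h3 : (0 : ℝ) ≤ Γ.length := by positivity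
      have h4 : 0 ≤ δ * M := mul_nonneg hδ0 hM0
      have h5 : 0 ≤ (Γ.length : ℝ) * (δ * M) := mul_nonneg h3 h4
      have key : (Γ.length : ℝ) ^ 2 * δ * M + δ * (Γ.length * M) ≤ ((Γ.length : ℝ) + 1) ^ 2 * δ * M := by
        have e1 : ((Γ.length : ℝ) + 1) ^ 2 * δ * M = (Γ.length : ℝ) ^ 2 * δ * M + δ * (Γ.length * M) + (Γ.length * (δ * M) + δ * M) := by ring
        rw [e1]
        linarith
      push_cast
      linarith

/-- occurrence numbers are at most the length. [cite: Balaban1985BackgroundPropagators, (3.169) p.430, bookkeeping] -/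
theorem occY_le_length {Bond : Type} [DecidableEq Bond] (q : Bond) : ∀ Γ : List Bond, occY q Γ ≤ Γ.length
  | [] => by simp [occY]
  | b :: Γ => by
      rw [occY, List.length_cons]
      have := occY_le_length q Γ
      push_cast
      split_ifs <;> linarith

omit [CompleteSpace 𝔸] in
/-- the plain sum of a bond delta along a list counts occurrences. [cite: Balaban1985BackgroundPropagators, (3.187) p.432, bookkeeping] -/
theorem list_sum_map_ite_eq {Bond : Type} [DecidableEq Bond] (b₀ : Bond) (v : 𝔸) :
    ∀ Γ : List Bond, (Γ.map fun b => if b = b₀ then v else 0).sum = occY b₀ Γ • v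
  | [] => by simp [occY]
  | b :: Γ => by
      rw [List.map_cons, List.sum_cons, occY, list_sum_map_ite_eq b₀ v Γ, add_smul]
      split_ifs <;> simp

omit [CompleteSpace 𝔸] in
/-- **the transpose of a transported sum along near-identity transports, read at a bond, differs from the occurrence multiple by at most `|Γ|²·δ`**.
[cite: Balaban1985BackgroundPropagators, (3.35) p.397, (3.169) p.430, bookkeeping] -/
theorem norm_trSumT_sub_occY_le {Bond : Type} [DecidableEq Bond] (S : Bond → 𝔸 ≃ₗ[ℝ] 𝔸) (hS : ∀ b v, ‖S b v‖ ≤ ‖v‖) {δ : ℝ} (hδ0 : 0 ≤ δ)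
    (hδ : ∀ b v, ‖S b v - v‖ ≤ δ * ‖v‖) (q : Bond) : ∀ (Γ : List Bond) (v : 𝔸), ‖trSumT S Γ v q - occY q Γ • v‖ ≤ Γ.length ^ 2 * δ * ‖v‖
  | [], v => by simp [occY]
  | b :: Γ, v => by
      rw [trSumT_cons, Pi.add_apply, sglY_apply, occY, add_smul, List.length_cons]
      have e : (if q = b then v else 0) + trSumT S Γ (S b v) q - ((if b = q then (1 : ℝ) else 0) • v + occY q Γ • v) =
          (trSumT S Γ (S b v) q - occY q Γ • S b v) + occY q Γ • (S b v - v) := by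
        have e0 : (if q = b then v else 0) = (if b = q then (1 : ℝ) else 0) • v := by
          by_cases h : b = q
          · rw [if_pos h, if_pos h.symm, one_smul]
          · rw [if_neg h, if_neg (Ne.symm h), zero_smul]
        rw [e0, smul_sub]; abel
      rw [e]
      refine (norm_add_le _ _).trans ?_
      have h3 : (0 : ℝ) ≤ Γ.length ^ 2 * δ := by positivity
      have i1 := (norm_trSumT_sub_occY_le S hS hδ0 hδ q Γ (S b v)).trans (mul_le_mul_of_nonneg_left (hS b v) h3)
      have i2 : ‖occY q Γ • (S b v - v)‖ ≤ Γ.length * (δ * ‖v‖) := by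
        rw [norm_smul, Real.norm_of_nonneg (occY_nonneg q Γ)]
        exact mul_le_mul (occY_le_length q Γ) (hδ b v) (norm_nonneg _) (by positivity)
      have h4 : (0 : ℝ) ≤ δ * ‖v‖ := by positivity
      have h5 : (0 : ℝ) ≤ Γ.length * (δ * ‖v‖) := by positivity
      have e1 : ((Γ.length : ℝ) + 1) ^ 2 * δ * ‖v‖ = (Γ.length : ℝ) ^ 2 * δ * ‖v‖ + Γ.length * (δ * ‖v‖) + (Γ.length * (δ * ‖v‖) + δ * ‖v‖) := by ring
      push_cast
      rw [e1]
      linarith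

/-- ★ **NEUMANN SERIES ON THE FIBRE**: an endomorphism `K` of the complete fibre with `‖(λK)a − a‖ ≤ κ‖a‖`, `κ < 1`, `λ ≠ 0`, is a unit of `Module.End ℂ 𝔸`
(`λK = 1 − T`, `‖T‖ ≤ κ < 1` in the Banach algebra `𝔸 →L[ℂ] 𝔸`). [cite: Balaban1985BackgroundPropagators, (3.35) p.397, p.428, bookkeeping] -/
theorem isUnit_of_norm_smul_sub_le (K : Module.End ℂ 𝔸) {Lp : ℂ} (hLp0 : Lp ≠ 0) {κ : ℝ} (hκ0 : 0 ≤ κ) (hκ1 : κ < 1)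
    (hdev : ∀ a : 𝔸, ‖(Lp • K) a - a‖ ≤ κ * ‖a‖) : IsUnit K := by
  have hbd : ∀ a : 𝔸, ‖(Lp • K) a‖ ≤ (κ + 1) * ‖a‖ := by
    intro a
    have e : (Lp • K) a = ((Lp • K) a - a) + a := by abel
    rw [e]
    refine (norm_add_le _ _).trans ?_
    have := hdev a
    linarith
  set Kc : 𝔸 →L[ℂ] 𝔸 := (Lp • K).mkContinuous (κ + 1) hbd with hKc
  have hKc_apply : ∀ a, Kc a = (Lp • K) a := fun a => LinearMap.mkContinuous_apply _ _ _ _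
  have hT : ‖(1 : 𝔸 →L[ℂ] 𝔸) - Kc‖ ≤ κ := by
    refine ContinuousLinearMap.opNorm_le_bound _ hκ0 (fun a => ?_)
    rw [sub_apply, one_apply_eq_self, norm_sub_rev, hKc_apply]
    exact hdev a
  have hT1 : ‖(1 : 𝔸 →L[ℂ] 𝔸) - Kc‖ < 1 := hT.trans_lt hκ1
  set u : (𝔸 →L[ℂ] 𝔸)ˣ := Units.oneSub ((1 : 𝔸 →L[ℂ] 𝔸) - Kc) hT1 with hudef
  have hu : (u : 𝔸 →L[ℂ] 𝔸) = Kc := by rw [hudef, Units.val_oneSub, sub_sub_cancel]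
  have hunit : IsUnit (Lp • K) := by
    refine isUnit_iff_exists.2 ⟨(((u⁻¹ : (𝔸 →L[ℂ] 𝔸)ˣ) : 𝔸 →L[ℂ] 𝔸) : 𝔸 →ₗ[ℂ] 𝔸), ?_, ?_⟩
    · apply LinearMap.ext
      intro a
      have h := congrArg (fun f : 𝔸 →L[ℂ] 𝔸 => f a) u.mul_inv
      simp only [mul_apply_eq_comp, one_apply_eq_self, hu, hKc_apply] at h
      rw [Module.End.mul_apply, Module.End.one_apply, ContinuousLinearMap.coe_coe]
      exact h
    · apply LinearMap.ext
      intro a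
      have h := congrArg (fun f : 𝔸 →L[ℂ] 𝔸 => f a) u.inv_mul
      simp only [mul_apply_eq_comp, one_apply_eq_self, hu, hKc_apply] at h
      rw [Module.End.mul_apply, Module.End.one_apply, ContinuousLinearMap.coe_coe]
      exact h
  have e : K = algebraMap ℂ (Module.End ℂ 𝔸) Lp⁻¹ * (Lp • K) := by
    rw [← Algebra.smul_def, smul_smul, inv_mul_cancel₀ hLp0, one_smul]
  rw [e]
  exact ((isUnit_iff_ne_zero.2 (inv_ne_zero hLp0)).map (algebraMap ℂ (Module.End ℂ 𝔸))).mul hunit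

end SmallField

/-! ## §2 The pivot coefficients `K_c(V)`, `K_c(V)*` in the small-field regime -/

section SmallK

variable {𝔸 : Type} [NormedRing 𝔸] [NormedAlgebra ℂ 𝔸] [CompleteSpace 𝔸]
variable (x : MemberY d ℓ hd hL b₀ b₁ Mstar) (𝔳 : AvY 𝔸 x)

omit [NormedAlgebra ℂ 𝔸] [CompleteSpace 𝔸] in
/-- labels separate unit sites. [cite: Balaban1985Averaging, p.24, bookkeeping] -/
theorem labK_injective : Function.Injective (labK x) := fun z z' e => by
  have := congrArg (ofZ x) e
  rwa [ofZ_labK, ofZ_labK] at this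

/-- **a block has at most `L^{d+1}` unit sites**. [cite: Balaban1985Averaging, p.24 («L^d» sites per block), bookkeeping] -/
theorem card_ublockY_le (y : USiteY x) : (ublockY x y).card ≤ (ℓ + 1) ^ (d + 1) := by
  classical
  rw [← B6Elimination.card_block (L := ℓ + 1) (corner (ℓ + 1) (labK x y))]
  refine Finset.card_le_card_of_injOn (labK x) (fun z hz => ?_) (fun z _ z' _ e => labK_injective x e)
  rw [Finset.mem_coe, mem_ublockY] at hz
  rw [Finset.mem_coe, ← hz]
  exact (mem_block_corner_iff ell_succ_pos).2 rfl

/-- the normalisation `L^{-(d+2)}` has norm `L^{-(d+2)}`. [cite: Balaban1985Averaging, (125) p.36, bookkeeping] -/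
theorem norm_qNormY : ‖qNormY d ℓ‖ = ((((ℓ + 1 : ℕ) : ℝ)) ^ (d + 2))⁻¹ := by
  rw [qNormY, norm_inv, norm_pow, Complex.norm_natCast]

open Classical in
/-- ★★ **SMALL FIELDS MOVE THE PIVOT COEFFICIENT LITTLE**: for a bond field `V = 𝔳 U` with values in a group of contractions (`‖g‖ ≤ 1`) and
`‖V(b) − 1‖ ≤ δ` on every unit bond, `‖K_c(V)a − L^{−(d+1)}a‖ ≤ 2δ·(L + (d+1)ℓ)·‖a‖` — each of the `L·L^{d+1}` (segment, bond) readings of the pivot is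
carried by at most `L + (d+1)ℓ` near-identity transports (print: the operators `R(V(Γ))` differ from `1` by `O(L²α₀)` under (3.35), [5] p.36).
[cite: Balaban1985Averaging, (125)–(126) p.36; Balaban1985BackgroundPropagators, (3.35) p.397, p.428] -/
theorem norm_KY_sub_le {G : Subgroup 𝔸ˣ} (hG1 : ∀ g ∈ G, ‖((g : 𝔸ˣ) : 𝔸)‖ ≤ 1) {U : CfgY 𝔸 x.toKIdx} (h𝔳 : ∀ b, 𝔳 U b ∈ G) {δ : ℝ} (hδ0 : 0 ≤ δ)
    (hδ : ∀ b, ‖((𝔳 U b : 𝔸ˣ) : 𝔸) - 1‖ ≤ δ) (c : CBondY x) (a : 𝔸) :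
    ‖KY x 𝔳 U c a - ((((ℓ + 1 : ℕ) : ℂ)) ^ (d + 1))⁻¹ • a‖ ≤ 2 * δ * (((ℓ + 1 : ℕ) + (d + 1) * ℓ : ℕ) : ℝ) * ‖a‖ := by
  rw [← KY_one x c a]
  obtain ⟨⟨y, μ⟩, hc⟩ := c
  have hT : ∀ (b : UBondY x) (v : 𝔸), ‖RUY x 𝔳 U b v‖ ≤ ‖v‖ := fun b v => by
    rw [RUY_apply]; exact B9Eq310Hermitian.norm_R_le (hG1 _ (h𝔳 b)) (hG1 _ (G.inv_mem (h𝔳 b))) v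
  have hTδ : ∀ (b : UBondY x) (v : 𝔸), ‖RUY x 𝔳 U b v - v‖ ≤ (2 * δ) * ‖v‖ := fun b v => by
    rw [RUY_apply]; exact norm_R_sub_self_le_of_le (hG1 _ (G.inv_mem (h𝔳 b))) (hδ b) v
  have hT' : ∀ (q : IBondY x.toKIdx) (v : 𝔸), ‖RVY x 𝔳 U q v‖ ≤ ‖v‖ := fun q v => hT _ v
  have hT'δ : ∀ (q : IBondY x.toKIdx) (v : 𝔸), ‖RVY x 𝔳 U q v - v‖ ≤ (2 * δ) * ‖v‖ := fun q v => hTδ _ v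
  have h1T : ∀ (b : UBondY x) (v : 𝔸), RUY x (avYOfRecord x) (fun _ _ => 1 : CfgY 𝔸 x.toKIdx) b v = v := fun b v => by
    rw [RUY_apply, avYOfRecord_one, R_one]
  set B : UBondY x → 𝔸 := readUY x (Pi.single (pivIY x ⟨(y, μ), hc⟩) a) with hB
  have hBle : ∀ b, ‖B b‖ ≤ ‖a‖ := by
    intro b
    rw [hB]
    unfold pivIY
    rw [readUY_single]
    split_ifs
    · exact le_rfl
    · rw [norm_zero]; exact norm_nonneg a
  rw [KY_apply, KY_apply, Q1Y_apply, Q1Y_apply, ← smul_sub, ← Finset.sum_sub_distrib, norm_smul, norm_qNormY]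
  simp only [hol_apply_of_id _ (RVY_avYOfRecord_one x), trSum_of_id _ h1T]
  have hz : ∀ z ∈ ublockY x y,
      ‖hol (RVY x 𝔳 U) (uΓ x z) (trSum (RUY x 𝔳 U) B (usegY x z μ)) - ((usegY x z μ).map B).sum‖ ≤
        2 * δ * (((ℓ + 1 : ℕ) + (d + 1) * ℓ : ℕ) : ℝ) * (((ℓ + 1 : ℕ) : ℝ) * ‖a‖) := by
    intro z _
    have e : hol (RVY x 𝔳 U) (uΓ x z) (trSum (RUY x 𝔳 U) B (usegY x z μ)) - ((usegY x z μ).map B).sum =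
        hol (RVY x 𝔳 U) (uΓ x z) (trSum (RUY x 𝔳 U) B (usegY x z μ) - ((usegY x z μ).map B).sum) +
          (hol (RVY x 𝔳 U) (uΓ x z) ((usegY x z μ).map B).sum - ((usegY x z μ).map B).sum) := by
      rw [map_sub]; abel
    rw [e]
    refine (norm_add_le _ _).trans ?_
    have i1 := (norm_hol_le _ hT' (uΓ x z) _).trans (norm_trSum_sub_sum_le _ hT (by positivity) hTδ B (norm_nonneg a) hBle (usegY x z μ))
    have i3 := norm_hol_sub_self_le _ hT' hT'δ (uΓ x z) ((usegY x z μ).map B).sum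
    have i4 := norm_list_sum_map_le B hBle (usegY x z μ)
    have i5 : ((uΓ x z).length : ℝ) ≤ ((d + 1) * ℓ : ℕ) := length_uΓ_le x z
    rw [length_usegY] at i1 i4
    have i6 : ((uΓ x z).length : ℝ) * (2 * δ) * ‖((usegY x z μ).map B).sum‖ ≤ (((d + 1) * ℓ : ℕ) : ℝ) * (2 * δ) * ((((ℓ + 1 : ℕ)) : ℝ) * ‖a‖) := by
      exact mul_le_mul (mul_le_mul_of_nonneg_right i5 (by positivity)) i4 (norm_nonneg _) (by positivity)
    have := norm_nonneg a
    push_cast at i1 i5 i6 ⊢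
    nlinarith
  refine (mul_le_mul_of_nonneg_left ((norm_sum_le _ _).trans (Finset.sum_le_card_nsmul _ _ _ hz)) (by positivity)).trans ?_
  rw [nsmul_eq_mul]
  have hcard : ((ublockY x y).card : ℝ) ≤ (((ℓ + 1 : ℕ) : ℝ)) ^ (d + 1) := by exact_mod_cast card_ublockY_le x y
  have hL : (0 : ℝ) < ((ℓ + 1 : ℕ) : ℝ) := by exact_mod_cast Nat.succ_pos ℓ
  have hK : (0 : ℝ) ≤ 2 * δ * (((ℓ + 1 : ℕ) + (d + 1) * ℓ : ℕ) : ℝ) * (((ℓ + 1 : ℕ) : ℝ) * ‖a‖) := by positivity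
  calc ((((ℓ + 1 : ℕ) : ℝ)) ^ (d + 2))⁻¹ * (((ublockY x y).card : ℝ) * (2 * δ * (((ℓ + 1 : ℕ) + (d + 1) * ℓ : ℕ) : ℝ) * (((ℓ + 1 : ℕ) : ℝ) * ‖a‖)))
      ≤ ((((ℓ + 1 : ℕ) : ℝ)) ^ (d + 2))⁻¹ * ((((ℓ + 1 : ℕ) : ℝ)) ^ (d + 1) * (2 * δ * (((ℓ + 1 : ℕ) + (d + 1) * ℓ : ℕ) : ℝ) * (((ℓ + 1 : ℕ) : ℝ) * ‖a‖))) := by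
        gcongr
    _ = 2 * δ * (((ℓ + 1 : ℕ) + (d + 1) * ℓ : ℕ) : ℝ) * ‖a‖ := by
        field_simp
        ring

/-- ★★★ **SMALL FIELDS: THE PIVOT COEFFICIENT IS A UNIT** — for `‖V(b) − 1‖ ≤ δ` with `2δ·L^{d+1}(L + (d+1)ℓ) < 1` (a (3.35)-type smallness, constants
depending on `d, L` only and cruder than print's) `K_c(V)` is invertible on the (complete) fibre: `L^{d+1}K_c(V) = 1 − T` with `‖T‖ < 1` (Neumann series).
Hence the faces `Q1Y_elimCY`, `elimCY_eq_self_of_constraints`, `sum_tr_elimCY_mul` of this file hold hypothesis-free in the small-field regime.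
[cite: Balaban1985BackgroundPropagators, (3.35) p.397, p.428 («a solution of the equation (Q(U_k)B)(c) = 0 considered as an equation on the variable B(b₀)»); Balaban1985Averaging, (126) p.36] -/
theorem isUnit_KY_of_small {G : Subgroup 𝔸ˣ} (hG1 : ∀ g ∈ G, ‖((g : 𝔸ˣ) : 𝔸)‖ ≤ 1) {U : CfgY 𝔸 x.toKIdx} (h𝔳 : ∀ b, 𝔳 U b ∈ G) {δ : ℝ} (hδ0 : 0 ≤ δ)
    (hδ : ∀ b, ‖((𝔳 U b : 𝔸ˣ) : 𝔸) - 1‖ ≤ δ)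
    (hsmall : (((ℓ + 1 : ℕ) : ℝ)) ^ (d + 1) * (2 * δ * (((ℓ + 1 : ℕ) + (d + 1) * ℓ : ℕ) : ℝ)) < 1) (c : CBondY x) :
    IsUnit (KY x 𝔳 U c) := by
  have hLp0 : ((((ℓ + 1 : ℕ) : ℂ)) ^ (d + 1)) ≠ 0 := pow_ne_zero _ (Nat.cast_ne_zero.2 (Nat.succ_ne_zero ℓ))
  have hLpn : ‖(((ℓ + 1 : ℕ) : ℂ)) ^ (d + 1)‖ = (((ℓ + 1 : ℕ) : ℝ)) ^ (d + 1) := by rw [norm_pow, Complex.norm_natCast]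
  refine isUnit_of_norm_smul_sub_le (KY x 𝔳 U c) hLp0 (by positivity) hsmall (fun a => ?_)
  have e : ((((ℓ + 1 : ℕ) : ℂ)) ^ (d + 1) • KY x 𝔳 U c) a - a = (((ℓ + 1 : ℕ) : ℂ)) ^ (d + 1) • (KY x 𝔳 U c a - ((((ℓ + 1 : ℕ) : ℂ)) ^ (d + 1))⁻¹ • a) := by
    rw [LinearMap.smul_apply, smul_sub, smul_inv_smul₀ hLp0]
  rw [e, norm_smul, hLpn, mul_assoc]
  exact mul_le_mul_of_nonneg_left (by simpa only [mul_assoc] using norm_KY_sub_le x 𝔳 hG1 h𝔳 hδ0 hδ c a) (by positivity)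

open Classical in
/-- ★★ **SMALL FIELDS MOVE THE TRANSPOSED PIVOT COEFFICIENT LITTLE**: `‖K_c(V)*v − L^{−(d+1)}v‖ ≤ 2δ·(L + (d+1)ℓ)·‖v‖` under the hypotheses of `norm_KY_sub_le`
(the transposed readings are carried by the inverse transports `Ad(V(b)⁻¹)`, `R(V(Γ))⁻¹`, equally close to `1`). [cite: Balaban1985Averaging, (125)–(126) p.36; Balaban1985BackgroundPropagators, (3.35) p.397, (3.9) p.391, p.428] -/
theorem norm_KTY_sub_le {G : Subgroup 𝔸ˣ} (hG1 : ∀ g ∈ G, ‖((g : 𝔸ˣ) : 𝔸)‖ ≤ 1) {U : CfgY 𝔸 x.toKIdx} (h𝔳 : ∀ b, 𝔳 U b ∈ G) {δ : ℝ} (hδ0 : 0 ≤ δ)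
    (hδ : ∀ b, ‖((𝔳 U b : 𝔸ˣ) : 𝔸) - 1‖ ≤ δ) (c : CBondY x) (v : 𝔸) :
    ‖KTY x 𝔳 U c v - ((((ℓ + 1 : ℕ) : ℂ)) ^ (d + 1))⁻¹ • v‖ ≤ 2 * δ * (((ℓ + 1 : ℕ) + (d + 1) * ℓ : ℕ) : ℝ) * ‖v‖ := by
  rw [← KY_one x c v]
  obtain ⟨⟨y, μ⟩, hc⟩ := c
  have hS : ∀ (b : UBondY x) (w : 𝔸), ‖RUTY x 𝔳 U b w‖ ≤ ‖w‖ := fun b w => by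
    rw [RUTY_apply]
    exact B9Eq310Hermitian.norm_R_le (hG1 _ (G.inv_mem (h𝔳 b))) (by rw [inv_inv]; exact hG1 _ (h𝔳 b)) w
  have hSδ : ∀ (b : UBondY x) (w : 𝔸), ‖RUTY x 𝔳 U b w - w‖ ≤ (2 * δ) * ‖w‖ := fun b w => by
    rw [RUTY_apply]
    refine norm_R_sub_self_le_of_le (V := (𝔳 U b)⁻¹) (by rw [inv_inv]; exact hG1 _ (h𝔳 b)) ?_ w
    exact ((B9Eq369Small.norm_inv_sub_one_le (hG1 _ (G.inv_mem (h𝔳 b)))).trans (by rw [one_mul])).trans (hδ b)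
  have hT' : ∀ (q : IBondY x.toKIdx) (w : 𝔸), ‖(RVY x 𝔳 U q).symm w‖ ≤ ‖w‖ := fun q w => hS (ubondOfIdx x q) w
  have hT'δ : ∀ (q : IBondY x.toKIdx) (w : 𝔸), ‖(RVY x 𝔳 U q).symm w - w‖ ≤ (2 * δ) * ‖w‖ := fun q w => hSδ (ubondOfIdx x q) w
  have h1T : ∀ (b : UBondY x) (w : 𝔸), RUY x (avYOfRecord x) (fun _ _ => 1 : CfgY 𝔸 x.toKIdx) b w = w := fun b w => by
    rw [RUY_apply, avYOfRecord_one, R_one]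
  rw [KTY_apply, KY_apply, Q1TY_apply, Q1Y_apply, Pi.smul_apply, ← smul_sub]
  unfold q1TFunY
  rw [Finset.sum_apply, ← Finset.sum_sub_distrib, norm_smul, norm_qNormY]
  unfold pivIY
  have hB : readUY x (Pi.single (idxOfU x (upivU x (y, μ)) (upivU_src_mem_Om x (isCoarseY_of x ⟨(y, μ), hc⟩))) v) =
      fun b => if b = upivU x (y, μ) then v else 0 := funext fun b => readUY_single x _ _ v b
  simp only [hol_apply_of_id _ (RVY_avYOfRecord_one x), trSum_of_id _ h1T, hB, placeUY_idxOfU, list_sum_map_ite_eq]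
  have hz : ∀ z ∈ ublockY x y,
      ‖trSumT (RUTY x 𝔳 U) (usegY x z μ) ((hol (RVY x 𝔳 U) (uΓ x z)).symm v) (upivU x (y, μ)) - occY (upivU x (y, μ)) (usegY x z μ) • v‖ ≤
        2 * δ * (((ℓ + 1 : ℕ) + (d + 1) * ℓ : ℕ) : ℝ) * (((ℓ + 1 : ℕ) : ℝ) * ‖v‖) := by
    intro z _
    set w := (hol (RVY x 𝔳 U) (uΓ x z)).symm v with hw
    have e : trSumT (RUTY x 𝔳 U) (usegY x z μ) w (upivU x (y, μ)) - occY (upivU x (y, μ)) (usegY x z μ) • v =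
        (trSumT (RUTY x 𝔳 U) (usegY x z μ) w (upivU x (y, μ)) - occY (upivU x (y, μ)) (usegY x z μ) • w) + occY (upivU x (y, μ)) (usegY x z μ) • (w - v) := by
      rw [smul_sub]; abel
    rw [e]
    refine (norm_add_le _ _).trans ?_
    have hwv : ‖w‖ ≤ ‖v‖ := norm_hol_symm_le _ hT' (uΓ x z) v
    have i1 := (norm_trSumT_sub_occY_le _ hS (by positivity) hSδ (upivU x (y, μ)) (usegY x z μ) w).trans
      (mul_le_mul_of_nonneg_left hwv (by positivity))
    have i3 : ‖w - v‖ ≤ (uΓ x z).length * (2 * δ) * ‖v‖ := norm_hol_symm_sub_self_le _ hT' (by positivity) hT'δ (uΓ x z) v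
    have i5 : ((uΓ x z).length : ℝ) ≤ ((d + 1) * ℓ : ℕ) := length_uΓ_le x z
    have i2 : ‖occY (upivU x (y, μ)) (usegY x z μ) • (w - v)‖ ≤ ((ℓ + 1 : ℕ) : ℝ) * (((d + 1) * ℓ : ℕ) * (2 * δ) * ‖v‖) := by
      rw [norm_smul, Real.norm_of_nonneg (occY_nonneg _ _)]
      refine mul_le_mul ((occY_le_length _ _).trans (by rw [length_usegY])) (i3.trans ?_) (norm_nonneg _) (by positivity)
      exact mul_le_mul_of_nonneg_right (mul_le_mul_of_nonneg_right i5 (by positivity)) (norm_nonneg v)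
    rw [length_usegY] at i1
    have := norm_nonneg v
    push_cast at i1 i2 ⊢
    nlinarith
  refine (mul_le_mul_of_nonneg_left ((norm_sum_le _ _).trans (Finset.sum_le_card_nsmul _ _ _ hz)) (by positivity)).trans ?_
  rw [nsmul_eq_mul]
  have hcard : ((ublockY x y).card : ℝ) ≤ (((ℓ + 1 : ℕ) : ℝ)) ^ (d + 1) := by exact_mod_cast card_ublockY_le x y
  have hL : (0 : ℝ) < ((ℓ + 1 : ℕ) : ℝ) := by exact_mod_cast Nat.succ_pos ℓ
  have hK : (0 : ℝ) ≤ 2 * δ * (((ℓ + 1 : ℕ) + (d + 1) * ℓ : ℕ) : ℝ) * (((ℓ + 1 : ℕ) : ℝ) * ‖v‖) := by positivity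
  calc ((((ℓ + 1 : ℕ) : ℝ)) ^ (d + 2))⁻¹ * (((ublockY x y).card : ℝ) * (2 * δ * (((ℓ + 1 : ℕ) + (d + 1) * ℓ : ℕ) : ℝ) * (((ℓ + 1 : ℕ) : ℝ) * ‖v‖)))
      ≤ ((((ℓ + 1 : ℕ) : ℝ)) ^ (d + 2))⁻¹ * ((((ℓ + 1 : ℕ) : ℝ)) ^ (d + 1) * (2 * δ * (((ℓ + 1 : ℕ) + (d + 1) * ℓ : ℕ) : ℝ) * (((ℓ + 1 : ℕ) : ℝ) * ‖v‖))) := by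
        gcongr
    _ = 2 * δ * (((ℓ + 1 : ℕ) + (d + 1) * ℓ : ℕ) : ℝ) * ‖v‖ := by
        field_simp
        ring

/-- ★★★ **SMALL FIELDS: THE TRANSPOSED PIVOT COEFFICIENT IS A UNIT** (same smallness as `isUnit_KY_of_small`); hence the adjointness face
`sum_tr_elimCY_mul` holds hypothesis-free in the small-field regime. [cite: Balaban1985BackgroundPropagators, (3.35) p.397, (3.9) p.391, p.428] -/
theorem isUnit_KTY_of_small {G : Subgroup 𝔸ˣ} (hG1 : ∀ g ∈ G, ‖((g : 𝔸ˣ) : 𝔸)‖ ≤ 1) {U : CfgY 𝔸 x.toKIdx} (h𝔳 : ∀ b, 𝔳 U b ∈ G) {δ : ℝ} (hδ0 : 0 ≤ δ)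
    (hδ : ∀ b, ‖((𝔳 U b : 𝔸ˣ) : 𝔸) - 1‖ ≤ δ)
    (hsmall : (((ℓ + 1 : ℕ) : ℝ)) ^ (d + 1) * (2 * δ * (((ℓ + 1 : ℕ) + (d + 1) * ℓ : ℕ) : ℝ)) < 1) (c : CBondY x) :
    IsUnit (KTY x 𝔳 U c) := by
  have hLp0 : ((((ℓ + 1 : ℕ) : ℂ)) ^ (d + 1)) ≠ 0 := pow_ne_zero _ (Nat.cast_ne_zero.2 (Nat.succ_ne_zero ℓ))
  have hLpn : ‖(((ℓ + 1 : ℕ) : ℂ)) ^ (d + 1)‖ = (((ℓ + 1 : ℕ) : ℝ)) ^ (d + 1) := by rw [norm_pow, Complex.norm_natCast]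
  refine isUnit_of_norm_smul_sub_le (KTY x 𝔳 U c) hLp0 (by positivity) hsmall (fun a => ?_)
  have e : ((((ℓ + 1 : ℕ) : ℂ)) ^ (d + 1) • KTY x 𝔳 U c) a - a = (((ℓ + 1 : ℕ) : ℂ)) ^ (d + 1) • (KTY x 𝔳 U c a - ((((ℓ + 1 : ℕ) : ℂ)) ^ (d + 1))⁻¹ • a) := by
    rw [LinearMap.smul_apply, smul_sub, smul_inv_smul₀ hLp0]
  rw [e, norm_smul, hLpn, mul_assoc]
  exact mul_le_mul_of_nonneg_left (by simpa only [mul_assoc] using norm_KTY_sub_le x 𝔳 hG1 h𝔳 hδ0 hδ c a) (by positivity)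

/-- **SMALL-FIELD PREDICATE** for an averaged field `V = 𝔳 U`: values in a group of contractions and `‖V(b) − 1‖ ≤ δ` on every unit bond, with the
smallness `L^{d+1}·2δ(L + (d+1)ℓ) < 1`. (Print's regime (3.35) is small CURVATURE; it reduces to this trivialised regime by the axial gauge of [5] (55),
(109) and the gauge covariance `K_c(V^u) = Ad(u(c₋)) K_c(V) Ad(u)⁻¹` — that reduction is NOT formalised here.) [cite: Balaban1985BackgroundPropagators, (3.35) p.397; Balaban1985Averaging, (109) p.34, (126) p.36] -/
def SmallVY (G : Subgroup 𝔸ˣ) (U : CfgY 𝔸 x.toKIdx) (δ : ℝ) : Prop :=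
  (∀ g ∈ G, ‖((g : 𝔸ˣ) : 𝔸)‖ ≤ 1) ∧ (∀ b, 𝔳 U b ∈ G) ∧ 0 ≤ δ ∧ (∀ b, ‖((𝔳 U b : 𝔸ˣ) : 𝔸) - 1‖ ≤ δ) ∧
    (((ℓ + 1 : ℕ) : ℝ)) ^ (d + 1) * (2 * δ * (((ℓ + 1 : ℕ) + (d + 1) * ℓ : ℕ) : ℝ)) < 1

/-- in the small-field regime every pivot coefficient is a unit. [cite: Balaban1985BackgroundPropagators, (3.35) p.397, p.428, bookkeeping] -/
theorem isUnit_KY_of_smallVY {G : Subgroup 𝔸ˣ} {U : CfgY 𝔸 x.toKIdx} {δ : ℝ} (h : SmallVY x 𝔳 G U δ) (c : CBondY x) : IsUnit (KY x 𝔳 U c) :=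
  isUnit_KY_of_small x 𝔳 h.1 h.2.1 h.2.2.1 h.2.2.2.1 h.2.2.2.2 c

/-- in the small-field regime every transposed pivot coefficient is a unit. [cite: Balaban1985BackgroundPropagators, (3.35) p.397, p.428, bookkeeping] -/
theorem isUnit_KTY_of_smallVY {G : Subgroup 𝔸ˣ} {U : CfgY 𝔸 x.toKIdx} {δ : ℝ} (h : SmallVY x 𝔳 G U δ) (c : CBondY x) : IsUnit (KTY x 𝔳 U c) :=
  isUnit_KTY_of_small x 𝔳 h.1 h.2.1 h.2.2.1 h.2.2.2.1 h.2.2.2.2 c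

/-- ★★ **SMALL FIELDS: THE RANGE OF `C(V)` SATISFIES THE AVERAGING CONSTRAINTS `(Q(V)·)(c) = 0` UNCONDITIONALLY** ((3.157): «QB = 0 on Λ′»).
[cite: Balaban1985BackgroundPropagators, (3.157) p.428; Balaban1985Averaging, (125) p.36] -/
theorem Q1Y_elimCY_of_smallVY {G : Subgroup 𝔸ˣ} {U : CfgY 𝔸 x.toKIdx} {δ : ℝ} (h : SmallVY x 𝔳 G U δ) (c : CBondY x) (B : IBondY x.toKIdx → 𝔸) :
    Q1Y x 𝔳 U c.1 (elimCY x 𝔳 U B) = 0 :=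
  Q1Y_elimCY x 𝔳 U (isUnit_KY_of_smallVY x 𝔳 h c) B

/-- ★★ **SMALL FIELDS: `C(V)` PARAMETRISES THE CONSTRAINED SUBSPACE** — every `B` supported on `Λ̃ ∪ pivots` with `(Q(V)B)(c) = 0` for all coarse `c` is `C(V)` of
its restriction: `B = C(V)B`. [cite: Balaban1985BackgroundPropagators, (3.157) p.428 («Λ̃ ... a solution of the equation»); Balaban1984PropagatorsII, (2.154)–(2.156) pp.249–250] -/
theorem elimCY_eq_self_of_constraints_of_smallVY {G : Subgroup 𝔸ˣ} {U : CfgY 𝔸 x.toKIdx} {δ : ℝ} (h : SmallVY x 𝔳 G U δ) (B : IBondY x.toKIdx → 𝔸)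
    (hsupp : ∀ q, ¬ lamTY x q → ¬ IsPivY x q → B q = 0) (hQ : ∀ c : CBondY x, Q1Y x 𝔳 U c.1 B = 0) : elimCY x 𝔳 U B = B :=
  elimCY_eq_self_of_constraints x 𝔳 U B (isUnit_KY_of_smallVY x 𝔳 h) hsupp hQ

/-- ★★ **SMALL FIELDS: `C(V)*` IS THE FLAT TRANSPOSE OF `C(V)` UNCONDITIONALLY** — `Σ_q τ((C B)(q)·A(q)) = Σ_q τ(B(q)·(C* A)(q))` for every tracial `τ`.
[cite: Balaban1985BackgroundPropagators, (3.157) p.428 («C*»), (3.9) p.391] -/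
theorem sum_tr_elimCY_mul_of_smallVY {G : Subgroup 𝔸ˣ} {U : CfgY 𝔸 x.toKIdx} {δ : ℝ} (h : SmallVY x 𝔳 G U δ) (τ : 𝔸 →ₗ[ℂ] ℂ)
    (hτ : ∀ a b : 𝔸, τ (a * b) = τ (b * a)) (B A : IBondY x.toKIdx → 𝔸) :
    ∑ q, τ (elimCY x 𝔳 U B q * A q) = ∑ q, τ (B q * elimCtY x 𝔳 U A q) :=
  sum_tr_elimCY_mul x 𝔳 τ hτ U (isUnit_KY_of_smallVY x 𝔳 h) (isUnit_KTY_of_smallVY x 𝔳 h) B A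

/-- ★ **`U = 1` IS IN THE SMALL-FIELD REGIME OF THE RECORD'S AVERAGE** (with `δ = 0`, any group of contractions containing `1`): the U = 1 faces of FILE 13 are the
`δ = 0` case of the small-field faces. [cite: Balaban1985BackgroundPropagators, p.428, bookkeeping] -/
theorem smallVY_avYOfRecord_one {G : Subgroup 𝔸ˣ} (hG1 : ∀ g ∈ G, ‖((g : 𝔸ˣ) : 𝔸)‖ ≤ 1) :
    SmallVY x (avYOfRecord x) G (fun _ _ => 1 : CfgY 𝔸 x.toKIdx) 0 := by
  refine ⟨hG1, fun b => ?_, le_rfl, fun b => ?_, ?_⟩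
  · rw [avYOfRecord_one]; exact G.one_mem
  · rw [avYOfRecord_one, Units.val_one, sub_self, norm_zero]
  · rw [mul_zero, zero_mul, mul_zero]; exact zero_lt_one

/-! ### §2c The point `U = 1` for the transposes (dag-ref-E READ-3 on FILE 13: the face `sum_tr_elimCY_mul` named in `KY_one`'s docstring also needs
`K_c(1)*` a unit — landed here: `KTY_one`, `isUnit_KTY_one`, and the hypothesis-free U = 1 trace pairing `sum_tr_elimCY_mul_one`) -/

omit [CompleteSpace 𝔸] in
/-- identity transports: the transpose transport sum along `Γ` deposits `v` once per occurrence of the bond. [cite: Balaban1985BackgroundPropagators, (3.9) p.391, bookkeeping] -/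
theorem trSumT_apply_of_id {Bond : Type} [DecidableEq Bond] (S : Bond → 𝔸 ≃ₗ[ℝ] 𝔸) (hS : ∀ b v, S b v = v) :
    ∀ (Γ : List Bond) (v : 𝔸) (q : Bond), trSumT S Γ v q = ((Γ.map fun b => if q = b then v else 0)).sum
  | [], v, q => by rw [trSumT_nil, List.map_nil, List.sum_nil, Pi.zero_apply]
  | b :: Γ, v, q => by rw [trSumT_cons, Pi.add_apply, sglY_apply, hS, trSumT_apply_of_id S hS Γ v q, List.map_cons, List.sum_cons]

/-- ★★ **THE TRANSPOSE PIVOT COEFFICIENT AT `U = 1` IS THE SCALAR `L^{−(d+1)}`**: `K_c(1)* v = L^{−(d+1)} v` — exactly `L` of the (block point, segment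
step) pairs of `Q(1)*` deposit at the pivot `b₀(c)` (the companion of FILE 13's `KY_one`; asked for by dag-ref-E READ-3).
[cite: Balaban1985BackgroundPropagators, (3.9) p.391, (3.157) p.428; Balaban1985Averaging, (125) p.36] -/
theorem KTY_one (c : CBondY x) (v : 𝔸) :
    KTY x (avYOfRecord x) (fun _ _ => 1 : CfgY 𝔸 x.toKIdx) c v = ((((ℓ + 1 : ℕ) : ℂ)) ^ (d + 1))⁻¹ • v := by
  classical
  obtain ⟨⟨y, μ⟩, hc⟩ := c
  have hy : IsCornerY x y := ((mem_coarseY x).1 hc).1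
  have hS : ∀ (b : UBondY x) (w : 𝔸), RUTY x (avYOfRecord x) (fun _ _ => 1 : CfgY 𝔸 x.toKIdx) b w = w := fun b w => by
    rw [RUTY_apply, avYOfRecord_one, inv_one, R_one]
  have hsymm : ∀ z : USiteY x, (hol (RVY x (avYOfRecord x) (fun _ _ => 1 : CfgY 𝔸 x.toKIdx)) (uΓ x z)).symm v = v := fun z => by
    rw [LinearEquiv.symm_apply_eq, hol_apply_of_id _ (RVY_avYOfRecord_one x)]
  have hz : ∀ z : USiteY x, (((usegY x z μ).map fun b => if upivU x (y, μ) = b then v else 0)).sum =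
      ∑ s ∈ Finset.range (ℓ + 1), if (⟨ofZ x (labK x z + ((s : ℕ) : ℤ) • unitVec μ), μ⟩ : UBondY x) = upivU x (y, μ) then v else 0 := by
    intro z
    rw [usegY, List.map_map, list_sum_range_map]
    refine Finset.sum_congr rfl fun s _ => ?_
    simp only [Function.comp_apply, @eq_comm _ (upivU x (y, μ))]
  rw [KTY_apply, Q1TY_apply, Pi.smul_apply]
  unfold q1TFunY pivIY
  rw [Finset.sum_apply]
  simp only [hsymm, placeUY_idxOfU, trSumT_apply_of_id _ hS, hz]
  rw [Finset.sum_comm]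
  have hs : ∀ s ∈ Finset.range (ℓ + 1),
      (∑ z ∈ ublockY x y, if (⟨ofZ x (labK x z + (s : ℤ) • unitVec μ), μ⟩ : UBondY x) = upivU x (y, μ) then v else 0) = v := by
    intro s hs
    rw [Finset.mem_range] at hs
    have hiff : ∀ z : USiteY x, (⟨ofZ x (labK x z + (s : ℤ) • unitVec μ), μ⟩ : UBondY x) = upivU x (y, μ) ↔
        z = ofZ x (labK x y + ((ℓ : ℤ) - s) • unitVec μ) := by
      intro z
      rw [← ofZ_add_eq_upivU_src_iff x hy z μ hs]
      constructor
      · intro e; exact congrArg PBond.src e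
      · intro e; exact congrArg (fun w => (⟨w, μ⟩ : UBondY x)) e
    simp_rw [hiff]
    rw [Finset.sum_ite_eq', if_pos (ofZ_add_mem_ublockY x hy μ (by omega) (by omega))]
  rw [Finset.sum_congr rfl hs, Finset.sum_const, Finset.card_range, ← Nat.cast_smul_eq_nsmul ℂ, smul_smul, qNormY, pow_succ, mul_inv,
    inv_mul_cancel_right₀ (Nat.cast_ne_zero.2 (Nat.succ_ne_zero ℓ))]

/-- ★ at `U = 1` every transpose pivot coefficient is a unit. [cite: Balaban1985BackgroundPropagators, (3.157) p.428, bookkeeping] -/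
theorem isUnit_KTY_one (c : CBondY x) : IsUnit (KTY x (avYOfRecord x) (fun _ _ => 1 : CfgY 𝔸 x.toKIdx) c) := by
  have hL : ((((ℓ + 1 : ℕ) : ℂ)) ^ (d + 1))⁻¹ ≠ 0 := inv_ne_zero (pow_ne_zero _ (Nat.cast_ne_zero.2 (Nat.succ_ne_zero ℓ)))
  have e : KTY x (avYOfRecord x) (fun _ _ => 1 : CfgY 𝔸 x.toKIdx) c = ((((ℓ + 1 : ℕ) : ℂ)) ^ (d + 1))⁻¹ • (1 : Module.End ℂ 𝔸) := by
    apply LinearMap.ext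
    intro v
    rw [KTY_one, LinearMap.smul_apply, Module.End.one_apply]
  rw [e, ← Algebra.algebraMap_eq_smul_one]
  exact (isUnit_iff_ne_zero.2 hL).map (algebraMap ℂ (Module.End ℂ 𝔸))

/-- ★★ **THE (3.157) TRACE PAIRING `Σ τ(C B · A) = Σ τ(B · C* A)` AT `U = 1`, HYPOTHESIS-FREE** (FILE 13's `sum_tr_elimCY_mul` with both unit binders
discharged by `isUnit_KY_one` ∕ `isUnit_KTY_one`; dag-ref-E READ-3). [cite: Balaban1985BackgroundPropagators, (3.157) p.428 («C*»), (3.9) p.391] -/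
theorem sum_tr_elimCY_mul_one (τ : 𝔸 →ₗ[ℂ] ℂ) (hτ : ∀ a b : 𝔸, τ (a * b) = τ (b * a)) (B A : IBondY x.toKIdx → 𝔸) :
    ∑ q, τ (elimCY x (avYOfRecord x) (fun _ _ => 1 : CfgY 𝔸 x.toKIdx) B q * A q) =
      ∑ q, τ (B q * elimCtY x (avYOfRecord x) (fun _ _ => 1 : CfgY 𝔸 x.toKIdx) A q) :=
  sum_tr_elimCY_mul x (avYOfRecord x) τ hτ _ (fun c => isUnit_KY_one x c) (fun c => isUnit_KTY_one x c) B A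

end SmallK

/-! ## §3 Record level: the v6 Sect. E letters in the small-field regime (fibre `M_N(ℂ)`, `G ≤ U(N)`) -/

section RecordV6Small

open scoped Matrix.Norms.L2Operator
open B7Prop2Explicit (unitaryUnits)

variable (N : ℕ) (θ : Stage3Params) (Mstar : ℕ) (𝔢₀ : SectEY N θ Mstar)

/-- **SMALL FIELDS OF RECORD**: for `G ≤ U(N)`, a `G`-valued background `U` whose averaged field of record `V = avYOfRecord x U` satisfies `‖V(b) − 1‖ ≤ δ` on the unit
bonds with `L^{d+1}·2δ(L + (d+1)ℓ) < 1` is in the small-field regime (`hG1` from the C⋆-identity, `G`-valuedness from `avYOfRecord_mem`).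
[cite: Balaban1985BackgroundPropagators, (3.35) pp.396–397, (3.40) p.397, bookkeeping] -/
theorem smallVY_avYOfRecord (x : MemberY θ.d₆ θ.ℓ₆ θ.hd' θ.hL' θ.b₀ θ.b₁ Mstar) {G : Subgroup (Matrix (Fin N) (Fin N) ℂ)ˣ}
    (hG : G ≤ unitaryUnits (Matrix (Fin N) (Fin N) ℂ)) {U : CfgY (Matrix (Fin N) (Fin N) ℂ) x.toKIdx} (hU : ∀ μ z, U μ z ∈ G) {δ : ℝ} (hδ0 : 0 ≤ δ)
    (hδ : ∀ b, ‖((avYOfRecord x U b : (Matrix (Fin N) (Fin N) ℂ)ˣ) : Matrix (Fin N) (Fin N) ℂ) - 1‖ ≤ δ)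
    (hsmall : (((θ.ℓ₆ + 1 : ℕ) : ℝ)) ^ (θ.d₆ + 1) * (2 * δ * (((θ.ℓ₆ + 1 : ℕ) + (θ.d₆ + 1) * θ.ℓ₆ : ℕ) : ℝ)) < 1) :
    SmallVY x (avYOfRecord x) G U δ :=
  ⟨norm_coe_le_one_of_le_unitaryUnits hG, fun b => avYOfRecord_mem x hU b, hδ0, hδ, hsmall⟩

/-- ★★ **THE v6 RECORD'S `C ∕ C*` ARE TRACE-TRANSPOSES OF EACH OTHER IN THE SMALL-FIELD REGIME — NO `IsUnit` HYPOTHESES**.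
[cite: Balaban1985BackgroundPropagators, (3.157) p.428 («C*»), (3.9) p.391, (3.35) p.397] -/
theorem sum_trace_elimC_elimCt_sectEYOfRecordV6_of_smallVY (x : MemberY θ.d₆ θ.ℓ₆ θ.hd' θ.hL' θ.b₀ θ.b₁ Mstar)
    {G : Subgroup (Matrix (Fin N) (Fin N) ℂ)ˣ} {U : CfgY (Matrix (Fin N) (Fin N) ℂ) x.toKIdx} {δ : ℝ} (h : SmallVY x (avYOfRecord x) G U δ)
    (B A : IBondY x.toKIdx → Matrix (Fin N) (Fin N) ℂ) :
    ∑ q, Matrix.trace ((sectEYOfRecordV6 N θ Mstar 𝔢₀ x).elimC U B q * A q) =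
      ∑ q, Matrix.trace (B q * (sectEYOfRecordV6 N θ Mstar 𝔢₀ x).elimCt U A q) :=
  sum_trace_elimC_elimCt_sectEYOfRecordV6 N θ Mstar 𝔢₀ x U (isUnit_KY_of_smallVY x _ h) (isUnit_KTY_of_smallVY x _ h) B A

/-- ★★ **THE v6 RECORD'S `C` MAPS INTO THE CONSTRAINED SUBSPACE IN THE SMALL-FIELD REGIME**: `(Q(V)(C B))(c) = 0` at every coarse bond, no `IsUnit` hypothesis.
[cite: Balaban1985BackgroundPropagators, (3.157) p.428; Balaban1985Averaging, (125) p.36] -/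
theorem Q1Y_elimC_sectEYOfRecordV6_of_smallVY (x : MemberY θ.d₆ θ.ℓ₆ θ.hd' θ.hL' θ.b₀ θ.b₁ Mstar)
    {G : Subgroup (Matrix (Fin N) (Fin N) ℂ)ˣ} {U : CfgY (Matrix (Fin N) (Fin N) ℂ) x.toKIdx} {δ : ℝ} (h : SmallVY x (avYOfRecord x) G U δ)
    (c : CBondY x) (B : IBondY x.toKIdx → Matrix (Fin N) (Fin N) ℂ) :
    Q1Y x (avYOfRecord x) U c.1 ((sectEYOfRecordV6 N θ Mstar 𝔢₀ x).elimC U B) = 0 :=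
  Q1Y_elimCY_of_smallVY x _ h c B

/-- ★★ **THE v6 RECORD'S `C` PARAMETRISES THE CONSTRAINED SUBSPACE IN THE SMALL-FIELD REGIME** (print's «B = CB̃», B̃ = B on Λ̃), no `IsUnit` hypothesis.
[cite: Balaban1985BackgroundPropagators, (3.157) p.428; Balaban1984PropagatorsII, (2.154)–(2.156) pp.249–250] -/
theorem elimC_sectEYOfRecordV6_eq_self_of_constraints_of_smallVY (x : MemberY θ.d₆ θ.ℓ₆ θ.hd' θ.hL' θ.b₀ θ.b₁ Mstar)
    {G : Subgroup (Matrix (Fin N) (Fin N) ℂ)ˣ} {U : CfgY (Matrix (Fin N) (Fin N) ℂ) x.toKIdx} {δ : ℝ} (h : SmallVY x (avYOfRecord x) G U δ)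
    (B : IBondY x.toKIdx → Matrix (Fin N) (Fin N) ℂ) (hsupp : ∀ q, ¬ lamTY x q → ¬ IsPivY x q → B q = 0)
    (hQ : ∀ c : CBondY x, Q1Y x (avYOfRecord x) U c.1 B = 0) : (sectEYOfRecordV6 N θ Mstar 𝔢₀ x).elimC U B = B :=
  elimCY_eq_self_of_constraints_of_smallVY x _ h B hsupp hQ

end RecordV6Small

/-! ## §4 Conjugation of the (3.169) transports along chains (generic) -/

section ChainConj

variable {X Bond 𝔤 : Type} [AddCommGroup 𝔤] [Module ℝ 𝔤]

/-- **TRANSPORTS CONJUGATED BY A SITE FUNCTION TELESCOPE ALONG CHAINS**: if `T′(b) = A(b₋) T(b) A(b₊)⁻¹` on the bonds of a chain `Γ` from `y` to `z`, then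
`T′(Γ) = A(y) T(Γ) A(z)⁻¹` (print's «R(U^u(Γ_{y,x})) = R(u(y))R(U(Γ_{y,x}))R(u⁻¹(x))», (3.32)). [cite: Balaban1985BackgroundPropagators, (3.32) pp.395–396; Balaban1985Averaging, (55) p.27] -/
theorem hol_conj_apply (σ τ : Bond → X) (A : X → 𝔤 ≃ₗ[ℝ] 𝔤) (T T' : Bond → 𝔤 ≃ₗ[ℝ] 𝔤) :
    ∀ {y : X} {Γ : List Bond} {z : X}, IsChainFrom σ τ y Γ z → (∀ b ∈ Γ, ∀ v, T' b v = A (σ b) (T b ((A (τ b)).symm v))) →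
      ∀ v, hol T' Γ v = A y (hol T Γ ((A z).symm v))
  | y, [], z, h, _, v => by
      rw [isChainFrom_nil] at h
      subst h
      rw [hol_nil, hol_nil, LinearEquiv.refl_apply, LinearEquiv.refl_apply, LinearEquiv.apply_symm_apply]
  | y, b :: Γ, z, h, hT, v => by
      rw [isChainFrom_cons] at h
      obtain ⟨hb, h'⟩ := h
      rw [hol_cons_apply, hol_cons_apply, hol_conj_apply σ τ A T T' h' (fun b' hb' => hT b' (List.mem_cons_of_mem _ hb')) v, hT b (by simp),
        LinearEquiv.symm_apply_apply, hb]

/-- the inverse transports telescope the other way: `T′(Γ)⁻¹ = A(z) T(Γ)⁻¹ A(y)⁻¹`. [cite: Balaban1985BackgroundPropagators, (3.32) pp.395–396, bookkeeping] -/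
theorem hol_conj_symm_apply (σ τ : Bond → X) (A : X → 𝔤 ≃ₗ[ℝ] 𝔤) (T T' : Bond → 𝔤 ≃ₗ[ℝ] 𝔤) {y : X} {Γ : List Bond} {z : X} (h : IsChainFrom σ τ y Γ z)
    (hT : ∀ b ∈ Γ, ∀ v, T' b v = A (σ b) (T b ((A (τ b)).symm v))) (v : 𝔤) : (hol T' Γ).symm v = A z ((hol T Γ).symm ((A y).symm v)) := by
  apply (hol T' Γ).injective
  rw [LinearEquiv.apply_symm_apply, hol_conj_apply σ τ A T T' h hT, LinearEquiv.symm_apply_apply, LinearEquiv.apply_symm_apply,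
    LinearEquiv.apply_symm_apply]

/-- **TRANSPORTED SUMS ARE COVARIANT**: with `T′` as above and `B′(b) = A(b₋)B(b)` on `Γ`, `(R_y(V′)B′)(Γ) = A(y)(R_y(V)B)(Γ)`.
[cite: Balaban1985BackgroundPropagators, (3.32) pp.395–396, (3.169) p.430; Balaban1985Averaging, (55) p.27] -/
theorem trSum_conj (σ τ : Bond → X) (A : X → 𝔤 ≃ₗ[ℝ] 𝔤) (T T' : Bond → 𝔤 ≃ₗ[ℝ] 𝔤) (B B' : Bond → 𝔤) :
    ∀ {y : X} {Γ : List Bond} {z : X}, IsChainFrom σ τ y Γ z → (∀ b ∈ Γ, ∀ v, T' b v = A (σ b) (T b ((A (τ b)).symm v))) →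
      (∀ b ∈ Γ, B' b = A (σ b) (B b)) → trSum T' B' Γ = A y (trSum T B Γ)
  | y, [], z, _, _, _ => by rw [trSum_nil, trSum_nil, map_zero]
  | y, b :: Γ, z, h, hT, hB => by
      rw [isChainFrom_cons] at h
      obtain ⟨hb, h'⟩ := h
      rw [trSum_cons, trSum_cons, trSum_conj σ τ A T T' B B' h' (fun b' hb' => hT b' (List.mem_cons_of_mem _ hb')) fun b' hb' => hB b' (List.mem_cons_of_mem _ hb'),
        hT b (by simp), LinearEquiv.symm_apply_apply, hB b (by simp), hb, map_add]

end ChainConj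

section ChainConjT

variable {X Bond 𝔤 : Type} [NormedAddCommGroup 𝔤] [NormedSpace ℝ 𝔤] [DecidableEq Bond]

/-- **THE TRANSPOSES ARE COVARIANT**: if `S′(b) = A(b₊) S(b) A(b₋)⁻¹` on the bonds of a chain `Γ` from `y`, then `trSumT S′ Γ (A(y)v) (b) = A(b₋)(trSumT S Γ v (b))` at every bond.
[cite: Balaban1985BackgroundPropagators, (3.32) pp.395–396, (3.9) p.391, (3.169) p.430] -/
theorem trSumT_conj (σ τ : Bond → X) (A : X → 𝔤 ≃ₗ[ℝ] 𝔤) (S S' : Bond → 𝔤 ≃ₗ[ℝ] 𝔤) :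
    ∀ {y : X} {Γ : List Bond} {z : X}, IsChainFrom σ τ y Γ z → (∀ b ∈ Γ, ∀ w, S' b w = A (τ b) (S b ((A (σ b)).symm w))) →
      ∀ (v : 𝔤) (q : Bond), trSumT S' Γ (A y v) q = A (σ q) (trSumT S Γ v q)
  | y, [], z, _, _, v, q => by rw [trSumT_nil, trSumT_nil, Pi.zero_apply, map_zero]
  | y, b :: Γ, z, h, hS, v, q => by
      rw [isChainFrom_cons] at h
      obtain ⟨hb, h'⟩ := h
      rw [trSumT_cons, trSumT_cons, Pi.add_apply, Pi.add_apply, hS b (by simp), hb, LinearEquiv.symm_apply_apply,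
        trSumT_conj σ τ A S S' h' (fun b' hb' => hS b' (List.mem_cons_of_mem _ hb')) (S b v) q, map_add, sglY_apply, sglY_apply]
      by_cases hq : q = b
      · subst hq
        rw [if_pos rfl, if_pos rfl, hb]
      · rw [if_neg hq, if_neg hq, map_zero]

end ChainConjT

/-! ## §5 Gauge covariance (3.32)–(3.34) of `Q(V)`, `K_c(V)`, `K_c(V)*` under `V ↦ V^γ`; invertibility on gauge orbits of small fields -/

section GaugeK

variable {𝔸 : Type} [NormedRing 𝔸] [NormedAlgebra ℂ 𝔸] [CompleteSpace 𝔸]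
variable (x : MemberY d ℓ hd hL b₀ b₁ Mstar)

omit [NormedAlgebra ℂ 𝔸] [CompleteSpace 𝔸] in
/-- **THE GAUGE ACTION (55) OF [5] ON UNIT-LATTICE BOND VARIABLES**: `V^γ(b) = γ(b₋) V(b) γ(b₊)⁻¹` (print: «V′^u(x, x′) = u(x)V′(x, x′)u⁻¹(x′)»).
[cite: Balaban1985Averaging, (55) p.27; Balaban1985BackgroundPropagators, (3.28) p.395] -/
def ugaugeY (γ : USiteY x → 𝔸ˣ) (V : UBondY x → 𝔸ˣ) : UBondY x → 𝔸ˣ := fun b => γ b.src * V b * (γ b.tgt)⁻¹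

omit [NormedAlgebra ℂ 𝔸] [CompleteSpace 𝔸] in
/-- (55) unfolded. [cite: Balaban1985Averaging, (55) p.27, bookkeeping] -/
theorem ugaugeY_apply (γ : USiteY x → 𝔸ˣ) (V : UBondY x → 𝔸ˣ) (b : UBondY x) : ugaugeY x γ V b = γ b.src * V b * (γ b.tgt)⁻¹ := rfl

omit [NormedAlgebra ℂ 𝔸] [CompleteSpace 𝔸] in
/-- the trivial gauge acts trivially. [cite: Balaban1985Averaging, (55) p.27, bookkeeping] -/
@[simp] theorem ugaugeY_one (V : UBondY x → 𝔸ˣ) : ugaugeY x (fun _ => 1) V = V := by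
  funext b; simp [ugaugeY]

/-- `R(γ(s))` at a unit site, as a real-linear automorphism of the fibre. [cite: Balaban1985BackgroundPropagators, (3.28) p.395 («R(u(x))»), bookkeeping] -/
def RgY (γ : USiteY x → 𝔸ˣ) (s : USiteY x) : 𝔸 ≃ₗ[ℝ] 𝔸 := (adEquivY (γ s)).restrictScalars ℝ

omit [CompleteSpace 𝔸] in
/-- `RgY` evaluated. [cite: Balaban1985BackgroundPropagators, (3.28) p.395, bookkeeping] -/
@[simp] theorem RgY_apply (γ : USiteY x → 𝔸ˣ) (s : USiteY x) (v : 𝔸) : RgY x γ s v = R (γ s) v := rfl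

omit [CompleteSpace 𝔸] in
/-- `RgY⁻¹` evaluated. [cite: Balaban1985BackgroundPropagators, (3.28) p.395, bookkeeping] -/
@[simp] theorem RgY_symm_apply (γ : USiteY x → 𝔸ˣ) (s : USiteY x) (v : 𝔸) : (RgY x γ s).symm v = R (γ s)⁻¹ v := rfl

variable (𝔳 𝔳' : AvY 𝔸 x) {γ : USiteY x → 𝔸ˣ} {U U' : CfgY 𝔸 x.toKIdx}

/-- ★ the unit-bond transports of a gauge-transformed averaged field: `R(V^γ(b)) = R(γ(b₋)) R(V(b)) R(γ(b₊))⁻¹`. [cite: Balaban1985BackgroundPropagators, (3.32) p.395; Balaban1985Averaging, (55)–(56) p.27] -/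
theorem RUY_ugauge (hV : ∀ b, 𝔳' U' b = ugaugeY x γ (𝔳 U) b) (b : UBondY x) (v : 𝔸) :
    RUY x 𝔳' U' b v = RgY x γ b.src (RUY x 𝔳 U b ((RgY x γ b.tgt).symm v)) := by
  rw [RUY_apply, RUY_apply, hV, ugaugeY_apply, RgY_apply, RgY_symm_apply, B9Eq39Adjoint.R_mul, B9Eq39Adjoint.R_mul]

/-- the inverse transports: `R(V^γ(b))⁻¹ = R(γ(b₊)) R(V(b))⁻¹ R(γ(b₋))⁻¹`. [cite: Balaban1985BackgroundPropagators, (3.32) p.395, (3.9) p.391, bookkeeping] -/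
theorem RUTY_ugauge (hV : ∀ b, 𝔳' U' b = ugaugeY x γ (𝔳 U) b) (b : UBondY x) (w : 𝔸) :
    RUTY x 𝔳' U' b w = RgY x γ b.tgt (RUTY x 𝔳 U b ((RgY x γ b.src).symm w)) := by
  rw [RUTY_apply, RUTY_apply, hV, ugaugeY_apply, RgY_apply, RgY_symm_apply, mul_inv_rev, mul_inv_rev, inv_inv, B9Eq39Adjoint.R_mul,
    B9Eq39Adjoint.R_mul]

/-- the contours `Γ_{ȳ,y}` consist of top-level index bonds. [cite: Balaban1985BackgroundPropagators, (3.169) p.430, bookkeeping] -/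
theorem exists_eq_idxOfU_of_mem_uΓ {z : USiteY x} {q : IBondY x.toKIdx} (hq : q ∈ uΓ x z) :
    ∃ (b : UBondY x) (h : b.src ∈ (domT x.hN x.D x.hk).Om x.k), q = idxOfU x b h := by
  classical
  by_cases hz : GoodY x z
  · unfold uΓ at hq
    rw [dif_pos hz] at hq
    obtain ⟨b', hb', rfl⟩ := List.mem_pmap.1 hq
    exact ⟨_, _, rfl⟩
  · rw [uΓ_of_not_good x hz] at hq
    simp at hq

/-- the index-bond transports of record at a top-level bond transform with `γ` at the unit ends. [cite: Balaban1985BackgroundPropagators, (3.32) p.395, (3.168) p.430] -/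
theorem RVY_ugauge_idxOfU (hV : ∀ b, 𝔳' U' b = ugaugeY x γ (𝔳 U) b) (b : UBondY x) (h : b.src ∈ (domT x.hN x.D x.hk).Om x.k) (v : 𝔸) :
    RVY x 𝔳' U' (idxOfU x b h) v = RgY x γ (usrc x (idxOfU x b h)) (RVY x 𝔳 U (idxOfU x b h) ((RgY x γ (utgt x (idxOfU x b h))).symm v)) := by
  rw [RVY_eq_RUY, RVY_eq_RUY, ubondOfIdx_idxOfU, usrc_idxOfU, utgt_idxOfU]
  exact RUY_ugauge x 𝔳 𝔳' hV b v

/-- ★ **(3.32) FOR THE COMBS**: `R(V^γ(Γ_{ȳ,y})) = R(γ(ȳ)) R(V(Γ_{ȳ,y})) R(γ(y))⁻¹`. [cite: Balaban1985BackgroundPropagators, (3.32) pp.395–396, (3.169) p.430] -/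
theorem hol_uΓ_ugauge (hV : ∀ b, 𝔳' U' b = ugaugeY x γ (𝔳 U) b) (z : USiteY x) (v : 𝔸) :
    hol (RVY x 𝔳' U') (uΓ x z) v = RgY x γ (ublk x z) (hol (RVY x 𝔳 U) (uΓ x z) ((RgY x γ z).symm v)) :=
  hol_conj_apply (usrc x) (utgt x) (RgY x γ) (RVY x 𝔳 U) (RVY x 𝔳' U') ((axialFrameY x).chain z)
    (fun q hq w => by
      obtain ⟨b, h, rfl⟩ := exists_eq_idxOfU_of_mem_uΓ x hq
      exact RVY_ugauge_idxOfU x 𝔳 𝔳' hV b h w) v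

/-- the inverse comb transports. [cite: Balaban1985BackgroundPropagators, (3.32) pp.395–396, (3.169) p.430, bookkeeping] -/
theorem hol_uΓ_symm_ugauge (hV : ∀ b, 𝔳' U' b = ugaugeY x γ (𝔳 U) b) (z : USiteY x) (v : 𝔸) :
    (hol (RVY x 𝔳' U') (uΓ x z)).symm v = RgY x γ z ((hol (RVY x 𝔳 U) (uΓ x z)).symm ((RgY x γ (ublk x z)).symm v)) :=
  hol_conj_symm_apply (usrc x) (utgt x) (RgY x γ) (RVY x 𝔳 U) (RVY x 𝔳' U') ((axialFrameY x).chain z)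
    (fun q hq w => by
      obtain ⟨b, h, rfl⟩ := exists_eq_idxOfU_of_mem_uΓ x hq
      exact RVY_ugauge_idxOfU x 𝔳 𝔳' hV b h w) v

omit [NormedAlgebra ℂ 𝔸] [CompleteSpace 𝔸] in
/-- straight runs of unit bonds are chains. [cite: Balaban1985Averaging, (14) p.19, bookkeeping] -/
theorem isChainFrom_map_range' (w : Fin (d + 1) → ℤ) (μ : Fin (d + 1)) : ∀ (n s₀ : ℕ),
    IsChainFrom PBond.src PBond.tgt (ofZ x (w + ((s₀ : ℕ) : ℤ) • unitVec μ))
      ((List.range' s₀ n).map fun s : ℕ => (⟨ofZ x (w + ((s : ℕ) : ℤ) • unitVec μ), μ⟩ : UBondY x)) (ofZ x (w + ((s₀ + n : ℕ) : ℤ) • unitVec μ))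
  | 0, s₀ => by rw [List.range'_zero, List.map_nil, isChainFrom_nil]; rfl
  | n + 1, s₀ => by
      rw [List.range'_succ, List.map_cons, isChainFrom_cons]
      refine ⟨rfl, ?_⟩
      have h := isChainFrom_map_range' w μ n (s₀ + 1)
      have e1 : PBond.tgt (⟨ofZ x (w + ((s₀ : ℕ) : ℤ) • unitVec μ), μ⟩ : UBondY x) = ofZ x (w + ((s₀ + 1 : ℕ) : ℤ) • unitVec μ) := by
        show (ofZ x (w + ((s₀ : ℕ) : ℤ) • unitVec μ)).shift μ = _
        rw [← ofZ_add_unitVec, add_assoc, Nat.cast_succ, add_smul, one_smul]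
      rw [e1]
      convert h using 2
      rw [Nat.add_right_comm, Nat.add_assoc]

omit [NormedAlgebra ℂ 𝔸] [CompleteSpace 𝔸] in
/-- ★ the segment `[z, z(c)]` is a chain from `z` to `z(c) = z + L·e_μ`. [cite: Balaban1985Averaging, (14) p.19, (125) p.36] -/
theorem usegY_chain (z : USiteY x) (μ : Fin (d + 1)) :
    IsChainFrom PBond.src PBond.tgt z (usegY x z μ) (ofZ x (labK x z + ((ℓ + 1 : ℕ) : ℤ) • unitVec μ)) := by
  have h := isChainFrom_map_range' x (labK x z) μ (ℓ + 1) 0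
  rw [Nat.cast_zero, zero_smul, add_zero, ofZ_labK, Nat.zero_add, ← List.range_eq_range'] at h
  exact h

/-- ★ **(55) FOR THE SEGMENT SUMS**: `(R_z(V^γ)B^γ)([z, z(c)]) = R(γ(z)) (R_z(V)B)([z, z(c)])` for `B^γ(b) = R(γ(b₋))B(b)`.
[cite: Balaban1985Averaging, (55) p.27, (125) p.36; Balaban1985BackgroundPropagators, (3.32) p.395] -/
theorem trSum_usegY_ugauge (hV : ∀ b, 𝔳' U' b = ugaugeY x γ (𝔳 U) b) {B B' : UBondY x → 𝔸} (hB : ∀ b, B' b = R (γ b.src) (B b))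
    (z : USiteY x) (μ : Fin (d + 1)) : trSum (RUY x 𝔳' U') B' (usegY x z μ) = R (γ z) (trSum (RUY x 𝔳 U) B (usegY x z μ)) :=
  trSum_conj PBond.src PBond.tgt (RgY x γ) (RUY x 𝔳 U) (RUY x 𝔳' U') B B' (usegY_chain x z μ) (fun b _ v => RUY_ugauge x 𝔳 𝔳' hV b v)
    fun b _ => hB b

/-- the transposed segment sums: `trSumT(R(V^γ)*)([z, z(c)]) (R(γ(z))w) (b) = R(γ(b₋)) (trSumT(R(V)*)([z, z(c)]) w (b))`. [cite: Balaban1985BackgroundPropagators, (3.32) p.395, (3.9) p.391] -/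
theorem trSumT_usegY_ugauge (hV : ∀ b, 𝔳' U' b = ugaugeY x γ (𝔳 U) b) (z : USiteY x) (μ : Fin (d + 1)) (w : 𝔸) (b : UBondY x) :
    trSumT (RUTY x 𝔳' U') (usegY x z μ) (R (γ z) w) b = R (γ b.src) (trSumT (RUTY x 𝔳 U) (usegY x z μ) w b) := by
  classical
  exact trSumT_conj PBond.src PBond.tgt (RgY x γ) (RUTY x 𝔳 U) (RUTY x 𝔳' U') (usegY_chain x z μ) (fun b _ w => RUTY_ugauge x 𝔳 𝔳' hV b w) w b

omit [NormedAlgebra ℂ 𝔸] [CompleteSpace 𝔸] in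
/-- reading a gauge-transformed bond function: `read(R(γ(b₋))B)(b) = R(γ(b₋)) read(B)(b)`. [cite: Balaban1984PropagatorsII, (2.3) p.224; Balaban1985BackgroundPropagators, (3.28) p.395] -/
theorem readUY_conj (B : IBondY x.toKIdx → 𝔸) (b : UBondY x) :
    readUY x (fun q => R (γ (usrc x q)) (B q)) b = R (γ b.src) (readUY x B b) := by
  by_cases h : b.src ∈ (domT x.hN x.D x.hk).Om x.k
  · rw [readUY_apply_of_mem x _ h, readUY_apply_of_mem x _ h, usrc_idxOfU]
  · rw [readUY_apply_of_not_mem x _ h, readUY_apply_of_not_mem x _ h, B9Eq39Adjoint.R_zero]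

omit [NormedAlgebra ℂ 𝔸] [CompleteSpace 𝔸] in
/-- the points of a coarse block have the block's corner as representative. [cite: Balaban1985BackgroundPropagators, (3.169) p.430, p.427, bookkeeping] -/
theorem ublk_eq_of_mem_ublockY {y z : USiteY x} (hy : IsCornerY x y) (hg : GoodY x y) (hz : z ∈ ublockY x y) : ublk x z = y := by
  rw [ublk_of_good x (goodY_of_mem_ublockY x hg hz)]
  show ofZ x (corner (ℓ + 1) (labK x z)) = y
  rw [(mem_ublockY x).1 hz, (isCornerY_iff x y).1 hy, ofZ_labK]

/-- ★★ **`Q(V)` IS GAUGE COVARIANT** ((3.32) for the averaging operation (125) of gauge fields: «inspecting the definitions of the averaging operators Q_j(U) for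
gauge fields we can see that the equalities (3.32) hold again», p.396): `(Q(V^γ)(R(γ(·₋))B))(c) = R(γ(c₋)) (Q(V)B)(c)` at every `c` with `c₋` a good corner.
[cite: Balaban1985BackgroundPropagators, (3.32) pp.395–396; Balaban1985Averaging, (55) p.27, (125) p.36] -/
theorem Q1Y_ugauge (hV : ∀ b, 𝔳' U' b = ugaugeY x γ (𝔳 U) b) {c : USiteY x × Fin (d + 1)} (hc : IsCornerY x c.1) (hg : GoodY x c.1)
    (B : IBondY x.toKIdx → 𝔸) : Q1Y x 𝔳' U' c (fun q => R (γ (usrc x q)) (B q)) = R (γ c.1) (Q1Y x 𝔳 U c B) := by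
  rw [Q1Y_apply, Q1Y_apply, ← adEquivY_apply (γ c.1), map_smul, map_sum]
  congr 1
  refine Finset.sum_congr rfl fun z hz => ?_
  have hB : readUY x (fun q => R (γ (usrc x q)) (B q)) = fun b => R (γ b.src) (readUY x B b) := funext (readUY_conj x B)
  rw [hB, trSum_usegY_ugauge x 𝔳 𝔳' hV (fun b => rfl) z c.2, hol_uΓ_ugauge x 𝔳 𝔳' hV z, ublk_eq_of_mem_ublockY x hc hg hz, ← RgY_apply x γ z,
    LinearEquiv.symm_apply_apply, adEquivY_apply, RgY_apply]

omit [NormedAlgebra ℂ 𝔸] [CompleteSpace 𝔸] in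
/-- a placed fibre value transforms with `γ` at its bond's source. [cite: Balaban1985BackgroundPropagators, (3.28) p.395, bookkeeping] -/
theorem single_conj (q₀ : IBondY x.toKIdx) (a : 𝔸) :
    (fun q => R (γ (usrc x q)) ((Pi.single q₀ a : IBondY x.toKIdx → 𝔸) q)) = Pi.single q₀ (R (γ (usrc x q₀)) a) := by
  classical
  funext q
  by_cases h : q = q₀
  · subst h
    rw [Pi.single_eq_same, Pi.single_eq_same]
  · rw [Pi.single_eq_of_ne h, Pi.single_eq_of_ne h, B9Eq39Adjoint.R_zero]

/-- ★★ **THE PIVOT COEFFICIENT IS GAUGE COVARIANT**: `K_c(V^γ) R(γ(b₀(c)₋)) = R(γ(c₋)) K_c(V)`. [cite: Balaban1985BackgroundPropagators, (3.32)–(3.34) pp.395–396, (3.157) p.428] -/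
theorem KY_ugauge (hV : ∀ b, 𝔳' U' b = ugaugeY x γ (𝔳 U) b) (c : CBondY x) (a : 𝔸) :
    KY x 𝔳' U' c (R (γ (upivU x c.1).src) a) = R (γ c.1.1) (KY x 𝔳 U c a) := by
  rw [KY_apply, KY_apply]
  have h1 : (Pi.single (pivIY x c) (R (γ (upivU x c.1).src) a) : IBondY x.toKIdx → 𝔸) =
      fun q => R (γ (usrc x q)) ((Pi.single (pivIY x c) a : IBondY x.toKIdx → 𝔸) q) := by
    rw [single_conj]; unfold pivIY; rw [usrc_idxOfU]
  rw [h1]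
  exact Q1Y_ugauge x 𝔳 𝔳' hV (isCoarseY_of x c).1 (isCoarseY_of x c).2.1 _

/-- the covariance as an identity of endomorphisms: `K_c(V^γ) ∘ Ad γ(b₀(c)₋) = Ad γ(c₋) ∘ K_c(V)`. [cite: Balaban1985BackgroundPropagators, (3.34) p.396, (3.157) p.428] -/
theorem KY_ugauge_comp (hV : ∀ b, 𝔳' U' b = ugaugeY x γ (𝔳 U) b) (c : CBondY x) :
    KY x 𝔳' U' c * (adEquivY (γ (upivU x c.1).src) : 𝔸 ≃ₗ[ℂ] 𝔸).toLinearMap = (adEquivY (γ c.1.1) : 𝔸 ≃ₗ[ℂ] 𝔸).toLinearMap * KY x 𝔳 U c :=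
  LinearMap.ext fun a => KY_ugauge x 𝔳 𝔳' hV c a

omit [CompleteSpace 𝔸] in
/-- `Ad W` is a unit of the endomorphism ring of the fibre. [cite: Balaban1985BackgroundPropagators, p.390 («R(U)X = UXU⁻¹»), bookkeeping] -/
theorem isUnit_adEquivY_toLinearMap (W : 𝔸ˣ) : IsUnit ((adEquivY W : 𝔸 ≃ₗ[ℂ] 𝔸).toLinearMap : Module.End ℂ 𝔸) :=
  isUnit_iff_exists.2 ⟨(adEquivY W).symm.toLinearMap, LinearMap.ext fun a => by simp, LinearMap.ext fun a => by simp⟩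

/-- ★★★ **INVERTIBILITY OF `K_c(V)` IS A GAUGE-ORBIT PROPERTY**: `K_c(V^γ)` is a unit iff `K_c(V)` is. [cite: Balaban1985BackgroundPropagators, (3.34) p.396, (3.157) p.428, (3.35) p.397] -/
theorem isUnit_KY_ugauge_iff (hV : ∀ b, 𝔳' U' b = ugaugeY x γ (𝔳 U) b) (c : CBondY x) : IsUnit (KY x 𝔳' U' c) ↔ IsUnit (KY x 𝔳 U c) := by
  obtain ⟨u₀, hu₀⟩ := isUnit_adEquivY_toLinearMap (𝔸 := 𝔸) (γ (upivU x c.1).src)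
  obtain ⟨u₁, hu₁⟩ := isUnit_adEquivY_toLinearMap (𝔸 := 𝔸) (γ c.1.1)
  have h := KY_ugauge_comp x 𝔳 𝔳' hV c
  rw [← hu₀, ← hu₁] at h
  rw [← Units.isUnit_mul_units (KY x 𝔳' U' c) u₀, h, Units.isUnit_units_mul]

omit [CompleteSpace 𝔸] in
/-- `P_S` commutes with the gauge action on bond functions. [cite: Balaban1985BackgroundPropagators, (3.157) p.428, (3.28) p.395, bookkeeping] -/
theorem secY_conj (S : IBondY x.toKIdx → Prop) (B : IBondY x.toKIdx → 𝔸) :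
    secY 𝔸 S (fun q => R (γ (usrc x q)) (B q)) = fun q => R (γ (usrc x q)) (secY 𝔸 S B q) := by
  funext q
  by_cases h : S q
  · rw [secY_apply_of h, secY_apply_of h]
  · rw [secY_apply_of_not h, secY_apply_of_not h, B9Eq39Adjoint.R_zero]

/-- ★ **`K_c(V)⁻¹` (as `Ring.inverse`) IS GAUGE COVARIANT**: `K_c(V^γ)⁻¹ Ad γ(c₋) = Ad γ(b₀(c)₋) K_c(V)⁻¹` — both sides `0` off the (common) invertibility locus.
[cite: Balaban1985BackgroundPropagators, (3.34) p.396, (3.157) p.428] -/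
theorem ringInverse_KY_ugauge (hV : ∀ b, 𝔳' U' b = ugaugeY x γ (𝔳 U) b) (c : CBondY x) (w : 𝔸) :
    Ring.inverse (KY x 𝔳' U' c) (R (γ c.1.1) w) = R (γ (upivU x c.1).src) (Ring.inverse (KY x 𝔳 U c) w) := by
  by_cases hK : IsUnit (KY x 𝔳 U c)
  · obtain ⟨u', hu'⟩ := (isUnit_KY_ugauge_iff x 𝔳 𝔳' hV c).2 hK
    obtain ⟨u, hu⟩ := hK
    have h := KY_ugauge_comp x 𝔳 𝔳' hV c
    rw [← hu, ← hu'] at h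
    have h3 : (adEquivY (γ (upivU x c.1).src) : 𝔸 ≃ₗ[ℂ] 𝔸).toLinearMap * ((u⁻¹ : (Module.End ℂ 𝔸)ˣ) : Module.End ℂ 𝔸) =
        ((u'⁻¹ : (Module.End ℂ 𝔸)ˣ) : Module.End ℂ 𝔸) * (adEquivY (γ c.1.1) : 𝔸 ≃ₗ[ℂ] 𝔸).toLinearMap :=
      calc (adEquivY (γ (upivU x c.1).src) : 𝔸 ≃ₗ[ℂ] 𝔸).toLinearMap * ((u⁻¹ : (Module.End ℂ 𝔸)ˣ) : Module.End ℂ 𝔸)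
          = ((u'⁻¹ : (Module.End ℂ 𝔸)ˣ) : Module.End ℂ 𝔸) * (((u' : (Module.End ℂ 𝔸)ˣ) : Module.End ℂ 𝔸) *
              (adEquivY (γ (upivU x c.1).src) : 𝔸 ≃ₗ[ℂ] 𝔸).toLinearMap) * ((u⁻¹ : (Module.End ℂ 𝔸)ˣ) : Module.End ℂ 𝔸) := by
            rw [Units.inv_mul_cancel_left]
        _ = ((u'⁻¹ : (Module.End ℂ 𝔸)ˣ) : Module.End ℂ 𝔸) * (adEquivY (γ c.1.1) : 𝔸 ≃ₗ[ℂ] 𝔸).toLinearMap := by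
            rw [h, mul_assoc, mul_assoc, Units.mul_inv, mul_one]
    have h4 := congrArg (fun L : Module.End ℂ 𝔸 => L w) h3
    simp only [Module.End.mul_apply, LinearEquiv.coe_coe, adEquivY_apply] at h4
    rw [← hu, ← hu', Ring.inverse_unit, Ring.inverse_unit]
    exact h4.symm
  · have hK' : ¬ IsUnit (KY x 𝔳' U' c) := fun h => hK ((isUnit_KY_ugauge_iff x 𝔳 𝔳' hV c).1 h)
    rw [Ring.inverse_non_unit _ hK, Ring.inverse_non_unit _ hK', LinearMap.zero_apply, LinearMap.zero_apply, B9Eq39Adjoint.R_zero]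

/-- ★★★ **THE LETTER `C(V)` OF (3.157) IS GAUGE COVARIANT**: `C(V^γ)(R(γ(·₋))B) = R(γ(·₋))(C(V)B)` — (3.34)'s law for the bond elimination, with no invertibility
or smallness hypothesis. [cite: Balaban1985BackgroundPropagators, (3.34) p.396, (3.157)–(3.158) p.428] -/
theorem elimCY_ugauge (hV : ∀ b, 𝔳' U' b = ugaugeY x γ (𝔳 U) b) (B : IBondY x.toKIdx → 𝔸) :
    elimCY x 𝔳' U' (fun q => R (γ (usrc x q)) (B q)) = fun q => R (γ (usrc x q)) (elimCY x 𝔳 U B q) := by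
  classical
  funext q
  rw [elimCY_apply, elimCY_apply, secY_conj, B9Eq39Adjoint.R_sub, ← adEquivY_apply (γ (usrc x q)) (∑ c : CBondY x, _), map_sum]
  congr 1
  refine Finset.sum_congr rfl fun c _ => ?_
  rw [adEquivY_apply]
  by_cases hq : q = pivIY x c
  · rw [if_pos hq, if_pos hq, Q1Y_ugauge x 𝔳 𝔳' hV (isCoarseY_of x c).1 (isCoarseY_of x c).2.1, ringInverse_KY_ugauge x 𝔳 𝔳' hV c, hq]
    unfold pivIY
    rw [usrc_idxOfU]
  · rw [if_neg hq, if_neg hq, B9Eq39Adjoint.R_zero]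

/-- ★★ **THE TRANSPOSE PIVOT COEFFICIENT IS GAUGE COVARIANT**: `K_c(V^γ)* R(γ(c₋)) = R(γ(b₀(c)₋)) K_c(V)*`. [cite: Balaban1985BackgroundPropagators, (3.32)–(3.34) pp.395–396, (3.9) p.391, (3.157) p.428] -/
theorem KTY_ugauge (hV : ∀ b, 𝔳' U' b = ugaugeY x γ (𝔳 U) b) (c : CBondY x) (v : 𝔸) :
    KTY x 𝔳' U' c (R (γ c.1.1) v) = R (γ (upivU x c.1).src) (KTY x 𝔳 U c v) := by
  classical
  rw [KTY_apply, KTY_apply, Q1TY_apply, Q1TY_apply, Pi.smul_apply, Pi.smul_apply, ← adEquivY_apply (γ (upivU x c.1).src), map_smul, adEquivY_apply]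
  congr 1
  unfold q1TFunY
  rw [Finset.sum_apply, Finset.sum_apply, ← adEquivY_apply (γ (upivU x c.1).src), map_sum]
  refine Finset.sum_congr rfl fun z hz => ?_
  rw [adEquivY_apply, hol_uΓ_symm_ugauge x 𝔳 𝔳' hV z, ublk_eq_of_mem_ublockY x (isCoarseY_of x c).1 (isCoarseY_of x c).2.1 hz, ← RgY_apply x γ c.1.1 v,
    LinearEquiv.symm_apply_apply, RgY_apply]
  have hT : trSumT (RUTY x 𝔳' U') (usegY x z c.1.2) (R (γ z) ((hol (RVY x 𝔳 U) (uΓ x z)).symm v)) =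
      fun b => R (γ b.src) (trSumT (RUTY x 𝔳 U) (usegY x z c.1.2) ((hol (RVY x 𝔳 U) (uΓ x z)).symm v) b) :=
    funext (trSumT_usegY_ugauge x 𝔳 𝔳' hV z c.1.2 _)
  rw [hT]
  unfold pivIY
  rw [placeUY_idxOfU, placeUY_idxOfU]

/-- the transpose covariance as an identity of endomorphisms. [cite: Balaban1985BackgroundPropagators, (3.34) p.396, (3.9) p.391] -/
theorem KTY_ugauge_comp (hV : ∀ b, 𝔳' U' b = ugaugeY x γ (𝔳 U) b) (c : CBondY x) :
    KTY x 𝔳' U' c * (adEquivY (γ c.1.1) : 𝔸 ≃ₗ[ℂ] 𝔸).toLinearMap = (adEquivY (γ (upivU x c.1).src) : 𝔸 ≃ₗ[ℂ] 𝔸).toLinearMap * KTY x 𝔳 U c :=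
  LinearMap.ext fun v => KTY_ugauge x 𝔳 𝔳' hV c v

/-- ★★★ invertibility of `K_c(V)*` is a gauge-orbit property. [cite: Balaban1985BackgroundPropagators, (3.34) p.396, (3.9) p.391, (3.157) p.428] -/
theorem isUnit_KTY_ugauge_iff (hV : ∀ b, 𝔳' U' b = ugaugeY x γ (𝔳 U) b) (c : CBondY x) : IsUnit (KTY x 𝔳' U' c) ↔ IsUnit (KTY x 𝔳 U c) := by
  obtain ⟨u₀, hu₀⟩ := isUnit_adEquivY_toLinearMap (𝔸 := 𝔸) (γ (upivU x c.1).src)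
  obtain ⟨u₁, hu₁⟩ := isUnit_adEquivY_toLinearMap (𝔸 := 𝔸) (γ c.1.1)
  have h := KTY_ugauge_comp x 𝔳 𝔳' hV c
  rw [← hu₀, ← hu₁] at h
  rw [← Units.isUnit_mul_units (KTY x 𝔳' U' c) u₁, h, Units.isUnit_units_mul]

omit [CompleteSpace 𝔸] in
/-- placing a gauge-transformed unit-bond function: `place(R(γ(b₋))W) = R(γ(·₋)) place(W)`. [cite: Balaban1984PropagatorsII, (2.3) p.224; Balaban1985BackgroundPropagators, (3.28) p.395, bookkeeping] -/
theorem placeUY_conj (W : UBondY x → 𝔸) : placeUY x (fun b => R (γ b.src) (W b)) = fun q => R (γ (usrc x q)) (placeUY x W q) := by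
  classical
  funext q
  unfold placeUY
  rw [← adEquivY_apply (γ (usrc x q)), map_sum]
  refine Finset.sum_congr rfl fun b _ => ?_
  by_cases h : b.src ∈ (domT x.hN x.D x.hk).Om x.k
  · rw [dif_pos h, dif_pos h]
    by_cases e : idxOfU x b h = q
    · rw [if_pos e, if_pos e, adEquivY_apply, ← e, usrc_idxOfU]
    · rw [if_neg e, if_neg e, map_zero]
  · rw [dif_neg h, dif_neg h, map_zero]

/-- ★★ **`Q(V)*` IS GAUGE COVARIANT**: `Q(V^γ)*(R(γ(c₋))v) = R(γ(·₋))(Q(V)* v)` at every `c` with `c₋` a good corner. [cite: Balaban1985BackgroundPropagators, (3.32)–(3.34) pp.395–396, (3.9) p.391; Balaban1985Averaging, (125) p.36] -/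
theorem Q1TY_ugauge (hV : ∀ b, 𝔳' U' b = ugaugeY x γ (𝔳 U) b) {c : USiteY x × Fin (d + 1)} (hc : IsCornerY x c.1) (hg : GoodY x c.1) (v : 𝔸) :
    Q1TY x 𝔳' U' c (R (γ c.1) v) = fun q => R (γ (usrc x q)) (Q1TY x 𝔳 U c v q) := by
  classical
  funext q
  rw [Q1TY_apply, Q1TY_apply, Pi.smul_apply, Pi.smul_apply, ← adEquivY_apply (γ (usrc x q)), map_smul, adEquivY_apply]
  congr 1
  unfold q1TFunY
  rw [Finset.sum_apply, Finset.sum_apply, ← adEquivY_apply (γ (usrc x q)), map_sum]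
  refine Finset.sum_congr rfl fun z hz => ?_
  rw [adEquivY_apply, hol_uΓ_symm_ugauge x 𝔳 𝔳' hV z, ublk_eq_of_mem_ublockY x hc hg hz, ← RgY_apply x γ c.1 v, LinearEquiv.symm_apply_apply, RgY_apply]
  have hT : trSumT (RUTY x 𝔳' U') (usegY x z c.2) (R (γ z) ((hol (RVY x 𝔳 U) (uΓ x z)).symm v)) =
      fun b => R (γ b.src) (trSumT (RUTY x 𝔳 U) (usegY x z c.2) ((hol (RVY x 𝔳 U) (uΓ x z)).symm v) b) :=
    funext (trSumT_usegY_ugauge x 𝔳 𝔳' hV z c.2 _)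
  rw [hT, placeUY_conj]

/-- ★ `K_c(V)*⁻¹` (as `Ring.inverse`) is gauge covariant: `K_c(V^γ)*⁻¹ Ad γ(b₀(c)₋) = Ad γ(c₋) K_c(V)*⁻¹`. [cite: Balaban1985BackgroundPropagators, (3.34) p.396, (3.9) p.391, (3.157) p.428] -/
theorem ringInverse_KTY_ugauge (hV : ∀ b, 𝔳' U' b = ugaugeY x γ (𝔳 U) b) (c : CBondY x) (w : 𝔸) :
    Ring.inverse (KTY x 𝔳' U' c) (R (γ (upivU x c.1).src) w) = R (γ c.1.1) (Ring.inverse (KTY x 𝔳 U c) w) := by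
  by_cases hK : IsUnit (KTY x 𝔳 U c)
  · obtain ⟨u', hu'⟩ := (isUnit_KTY_ugauge_iff x 𝔳 𝔳' hV c).2 hK
    obtain ⟨u, hu⟩ := hK
    have h := KTY_ugauge_comp x 𝔳 𝔳' hV c
    rw [← hu, ← hu'] at h
    have h3 : (adEquivY (γ c.1.1) : 𝔸 ≃ₗ[ℂ] 𝔸).toLinearMap * ((u⁻¹ : (Module.End ℂ 𝔸)ˣ) : Module.End ℂ 𝔸) =
        ((u'⁻¹ : (Module.End ℂ 𝔸)ˣ) : Module.End ℂ 𝔸) * (adEquivY (γ (upivU x c.1).src) : 𝔸 ≃ₗ[ℂ] 𝔸).toLinearMap :=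
      calc (adEquivY (γ c.1.1) : 𝔸 ≃ₗ[ℂ] 𝔸).toLinearMap * ((u⁻¹ : (Module.End ℂ 𝔸)ˣ) : Module.End ℂ 𝔸)
          = ((u'⁻¹ : (Module.End ℂ 𝔸)ˣ) : Module.End ℂ 𝔸) * (((u' : (Module.End ℂ 𝔸)ˣ) : Module.End ℂ 𝔸) *
              (adEquivY (γ c.1.1) : 𝔸 ≃ₗ[ℂ] 𝔸).toLinearMap) * ((u⁻¹ : (Module.End ℂ 𝔸)ˣ) : Module.End ℂ 𝔸) := by
            rw [Units.inv_mul_cancel_left]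
        _ = ((u'⁻¹ : (Module.End ℂ 𝔸)ˣ) : Module.End ℂ 𝔸) * (adEquivY (γ (upivU x c.1).src) : 𝔸 ≃ₗ[ℂ] 𝔸).toLinearMap := by
            rw [h, mul_assoc, mul_assoc, Units.mul_inv, mul_one]
    have h4 := congrArg (fun L : Module.End ℂ 𝔸 => L w) h3
    simp only [Module.End.mul_apply, LinearEquiv.coe_coe, adEquivY_apply] at h4
    rw [← hu, ← hu', Ring.inverse_unit, Ring.inverse_unit]
    exact h4.symm
  · have hK' : ¬ IsUnit (KTY x 𝔳' U' c) := fun h => hK ((isUnit_KTY_ugauge_iff x 𝔳 𝔳' hV c).1 h)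
    rw [Ring.inverse_non_unit _ hK, Ring.inverse_non_unit _ hK', LinearMap.zero_apply, LinearMap.zero_apply, B9Eq39Adjoint.R_zero]

/-- ★★★ **THE LETTER `C(V)*` OF (3.157) IS GAUGE COVARIANT**: `C(V^γ)*(R(γ(·₋))A) = R(γ(·₋))(C(V)*A)`, no hypothesis. [cite: Balaban1985BackgroundPropagators, (3.34) p.396, (3.157) p.428 («C*»), (3.9) p.391] -/
theorem elimCtY_ugauge (hV : ∀ b, 𝔳' U' b = ugaugeY x γ (𝔳 U) b) (A : IBondY x.toKIdx → 𝔸) :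
    elimCtY x 𝔳' U' (fun q => R (γ (usrc x q)) (A q)) = fun q => R (γ (usrc x q)) (elimCtY x 𝔳 U A q) := by
  classical
  rw [elimCtY_eq, elimCtY_eq, secY_conj]
  funext q
  rw [Pi.sub_apply, Pi.sub_apply, B9Eq39Adjoint.R_sub, Finset.sum_apply, Finset.sum_apply, ← adEquivY_apply (γ (usrc x q)) (∑ c : CBondY x, _), map_sum]
  congr 1
  refine Finset.sum_congr rfl fun c _ => ?_
  have e : R (γ (usrc x (pivIY x c))) (A (pivIY x c)) = R (γ (upivU x c.1).src) (A (pivIY x c)) := by unfold pivIY; rw [usrc_idxOfU]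
  rw [adEquivY_apply, e, ringInverse_KTY_ugauge x 𝔳 𝔳' hV c, Q1TY_ugauge x 𝔳 𝔳' hV (isCoarseY_of x c).1 (isCoarseY_of x c).2.1, secY_conj]

/-- ★★★ **`K_c(V)` AND `K_c(V)*` ARE UNITS WHENEVER `V` IS GAUGE EQUIVALENT TO A SMALL FIELD** — the mechanism of print's regime: (3.35) is a bound on
CURVATURE, and a small-curvature field is gauge equivalent (block axial gauge, [5] (55)–(58)) to a small one.
[cite: Balaban1985BackgroundPropagators, (3.35) pp.396–397, (3.34) p.396, (3.157) p.428; Balaban1985Averaging, (55)–(58) p.27, (126) p.36] -/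
theorem isUnit_KY_of_ugauge_smallVY {G : Subgroup 𝔸ˣ} {δ : ℝ} (h : SmallVY x 𝔳' G U' δ) (hV : ∀ b, 𝔳' U' b = ugaugeY x γ (𝔳 U) b) (c : CBondY x) :
    IsUnit (KY x 𝔳 U c) ∧ IsUnit (KTY x 𝔳 U c) :=
  ⟨(isUnit_KY_ugauge_iff x 𝔳 𝔳' hV c).1 (isUnit_KY_of_smallVY x 𝔳' h c), (isUnit_KTY_ugauge_iff x 𝔳 𝔳' hV c).1 (isUnit_KTY_of_smallVY x 𝔳' h c)⟩

/-- ★★ hence the hypothesis-free faces of `C(V)` on the whole gauge orbit of the small fields: constraints on the range. [cite: Balaban1985BackgroundPropagators, (3.157) p.428, (3.34)–(3.35) pp.396–397] -/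
theorem Q1Y_elimCY_of_ugauge_smallVY {G : Subgroup 𝔸ˣ} {δ : ℝ} (h : SmallVY x 𝔳' G U' δ) (hV : ∀ b, 𝔳' U' b = ugaugeY x γ (𝔳 U) b) (c : CBondY x)
    (B : IBondY x.toKIdx → 𝔸) : Q1Y x 𝔳 U c.1 (elimCY x 𝔳 U B) = 0 :=
  Q1Y_elimCY x 𝔳 U (isUnit_KY_of_ugauge_smallVY x 𝔳 𝔳' h hV c).1 B

/-- ★★ … and `C(V)` parametrises the constrained subspace on the whole gauge orbit of the small fields. [cite: Balaban1985BackgroundPropagators, (3.157) p.428; Balaban1984PropagatorsII, (2.154)–(2.156) pp.249–250] -/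
theorem elimCY_eq_self_of_constraints_of_ugauge_smallVY {G : Subgroup 𝔸ˣ} {δ : ℝ} (h : SmallVY x 𝔳' G U' δ) (hV : ∀ b, 𝔳' U' b = ugaugeY x γ (𝔳 U) b)
    (B : IBondY x.toKIdx → 𝔸) (hsupp : ∀ q, ¬ lamTY x q → ¬ IsPivY x q → B q = 0) (hQ : ∀ c : CBondY x, Q1Y x 𝔳 U c.1 B = 0) :
    elimCY x 𝔳 U B = B :=
  elimCY_eq_self_of_constraints x 𝔳 U B (fun c' => (isUnit_KY_of_ugauge_smallVY x 𝔳 𝔳' h hV c').1) hsupp hQ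

/-- ★★ … and `C(V)*` is the flat transpose of `C(V)` there. [cite: Balaban1985BackgroundPropagators, (3.157) p.428, (3.9) p.391] -/
theorem sum_tr_elimCY_mul_of_ugauge_smallVY {G : Subgroup 𝔸ˣ} {δ : ℝ} (h : SmallVY x 𝔳' G U' δ) (hV : ∀ b, 𝔳' U' b = ugaugeY x γ (𝔳 U) b)
    (τ : 𝔸 →ₗ[ℂ] ℂ) (hτ : ∀ a b : 𝔸, τ (a * b) = τ (b * a)) (B A : IBondY x.toKIdx → 𝔸) :
    ∑ q, τ (elimCY x 𝔳 U B q * A q) = ∑ q, τ (B q * elimCtY x 𝔳 U A q) :=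
  sum_tr_elimCY_mul x 𝔳 τ hτ U (fun c' => (isUnit_KY_of_ugauge_smallVY x 𝔳 𝔳' h hV c').1) (fun c' => (isUnit_KY_of_ugauge_smallVY x 𝔳 𝔳' h hV c').2) B A

/-- ★ **THE AVERAGED FIELD OF RECORD IS GAUGE COVARIANT**: `V(U^u)(b) = u(b₋) V(U)(b) u(b₊)⁻¹` with `u` read at the embedded unit sites (the taxicab transporters
transform as contour variables, `parBY_isGaugeLawB`). [cite: Balaban1985BackgroundPropagators, (3.28) p.395, (3.32) pp.395–396, (3.40) p.397, (3.168) p.430] -/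
theorem avYOfRecord_gaugeY (g : GaugeY 𝔸 x.toKIdx) (U : CfgY 𝔸 x.toKIdx) (b : UBondY x) :
    avYOfRecord x (gaugeY x.toKIdx g U) b = ugaugeY x (fun s => g (B15DeterminingSets.embIter x.k s)) (avYOfRecord x U) b :=
  parBY_isGaugeLawB x.toKIdx g U _ _

/-- ★★★ **AT THE RECORD: `K_c(V(U^u))` IS A UNIT IFF `K_c(V(U))` IS** (and the same for the transposes). [cite: Balaban1985BackgroundPropagators, (3.34) p.396, (3.157) p.428] -/
theorem isUnit_KY_avYOfRecord_gaugeY_iff (g : GaugeY 𝔸 x.toKIdx) (U : CfgY 𝔸 x.toKIdx) (c : CBondY x) :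
    (IsUnit (KY x (avYOfRecord x) (gaugeY x.toKIdx g U) c) ↔ IsUnit (KY x (avYOfRecord x) U c)) ∧
      (IsUnit (KTY x (avYOfRecord x) (gaugeY x.toKIdx g U) c) ↔ IsUnit (KTY x (avYOfRecord x) U c)) :=
  ⟨isUnit_KY_ugauge_iff x (avYOfRecord x) (avYOfRecord x) (avYOfRecord_gaugeY x g U) c,
    isUnit_KTY_ugauge_iff x (avYOfRecord x) (avYOfRecord x) (avYOfRecord_gaugeY x g U) c⟩

/-- ★★★ **AT THE RECORD: a background GAUGE EQUIVALENT TO ONE WITH SMALL AVERAGED FIELD has invertible pivot coefficients** — `SmallVY` for `U^u` ⇒ `K_c(V(U))`,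
`K_c(V(U))*` units. [cite: Balaban1985BackgroundPropagators, (3.35) pp.396–397, (3.34) p.396, (3.157) p.428; Balaban1985Averaging, (55) p.27] -/
theorem isUnit_KY_avYOfRecord_of_gaugeY_smallVY {G : Subgroup 𝔸ˣ} {δ : ℝ} (g : GaugeY 𝔸 x.toKIdx) {U : CfgY 𝔸 x.toKIdx}
    (h : SmallVY x (avYOfRecord x) G (gaugeY x.toKIdx g U) δ) (c : CBondY x) :
    IsUnit (KY x (avYOfRecord x) U c) ∧ IsUnit (KTY x (avYOfRecord x) U c) :=
  isUnit_KY_of_ugauge_smallVY x (avYOfRecord x) (avYOfRecord x) h (avYOfRecord_gaugeY x g U) c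

end GaugeK

end Literature.MathematicalPhysics.QuantumFieldTheory.Balaban1983to89.Node00

end
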